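import Mathlib.Analysis.SpecialFunctions.Gaussian.GaussianIntegral
import Mathlib.Analysis.SpecialFunctions.Exponential
import Mathlib.Analysis.SpecialFunctions.Pow.Real
import Mathlib.Analysis.Complex.CauchyIntegral
import Mathlib.MeasureTheory.Integral.Prod
import Mathlib.MeasureTheory.Constructions.Pi
import Mathlib.Analysis.SpecialFunctions.JapaneseBracket
import Mathlib.Topology.Algebra.Module.FiniteDimension
import HarnessLib

/-!
# Fröhlich–Spencer's complex translation lemma (FS81 Lemma 4.3, Condition (4.10); FS82 Lemma 3)

The engine of Fröhlich–Spencer's renormalisation of charge (monopole) activities in the dual,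
`ℤ`-valued representation of abelian lattice models is the estimation of integrals of analytic
functions of finitely many real variables by COMPLEX TRANSLATION of one variable at a time
([FS81, Sect. 4.2, Remark 2 p. 554]: "integrals of analytic functions of finitely many variables
`φ(j)` can be estimated by means of complex translations of the `φ(j)`'s. This is the principle
which we shall apply to renormalize multipole densities and activities"). The one-variable step is
[FS81, Lemma 4.3]: if the a priori weights `I_β` of the massless measure
`dμ(φ) ∝ ∏_{⟨kj⟩} I_β(φ(k) - φ(j)) ∏ dφ(j)` satisfy **Condition (4.10)** — even, positive,
integrable; analytic in a strip `|Im z| < ε`; `|I_β(φ + ia)/I_β(φ)| ≤ e^{c(β)a²}` — then for `G`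
independent of `φ(j₀)`,
`∫ e^{iqφ(j₀)} G dμ = e^{-qa + 4c(β)a²} ∫ e^{iqφ(j₀)} ∏_{|k-j₀|=1} ĩ_β(a; φ(j₀) - φ(k)) G dμ`
((4.15)), `|ĩ_β| ≤ 1`, whence the activity bound `e^{-E(β,q)}`, `E(β, q) = max_a {qa - 4c(β)a²}`
((4.16)). For the Gaussian weight of the Villain models this is an identity obtained by explicit
integration, [FS82, Lemma 3, (2.63)–(2.64)]: translating the dual gauge field `α_{xy}` on one link
of `ℤ⁴` through the `n_{xy} = 6` plaquettes containing it costs `e^{-(β/2n_{xy})ρ²_{xy}}`, the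
estimate that drives the perimeter law of four-dimensional `U(1)` lattice gauge theory
([FS82, §2.8–2.10]; named fact
`Literature.MathematicalPhysics.QuantumFieldTheory.FrohlichSpencerU1PerimeterLawD4` and its
corollary `Literature.Barriers.QuantumFields.AbelianDeconfinementD4`). For the cosine (Wilson)
action the same lemma is to be used with the analytic interpolation of the Bessel coefficients of
[FS81, Appendix B] ("This result can be extended to the compact U(1) model on `ℤ⁴` with Wilson's
action by combining the present techniques with an adaptation of Appendix B, Lemma 4.3 and of the
methods in Sect. 6 of [FS81]", [FS82, p. 433]); Appendix B is the tree's `BesselIDebyeAsymptotics`,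
`BesselIDebyeInterpolation`, `BesselIDebyeStrip`, and this file supplies Lemma 4.3 in a form that
covers both weights. Everything is PROVED; no named fact is introduced.

## Contents

* `integral_eq_integral_add_mul_I_of_integrable_strip` — the one-variable contour shift
  `∫ F(x) dx = ∫ F(x + ia) dx` for `F` holomorphic on the closed strip and integrable on it and on
  its two boundary lines; NO pointwise decay is assumed (the vertical sides are controlled in the
  mean), which is what products of merely integrable analytic weights require.
* `IsStripWeight ε w g f` — Condition (4.10) for one weight: `g > 0` on `ℝ`, `f` its continuation,
  holomorphic on `|Im z| < ε`, `|f(x + iy)| ≤ e^{w(y)} g(x)`; the penalty `w` (FS: `c(β)y²`, or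
  `c(β, |y|)y²`, or `g(y)/β` in Sect. 6 (c)) is any even non-decreasing function of `|y|` with
  `w(0) = 0`. API: continuity on lines, `norm_le_of_abs_le`, `penalty_nonneg`.
* `integral_cexp_mul_prod_eq_exp_mul_integral_translate` — **Lemma 4.3, identity form** on a
  product `ℝ × Y` (`Y` any s-finite measure space carrying all the other variables): for weights
  `∏ₚ fₚ(mₚ t + φₚ(y))`, a factor `G(y)` and the character `e^{iqt}`,
  `∫ e^{iqt} G ∏ₚ fₚ(mₚt + φₚ) = e^{-qa} ∫ e^{iqt} G ∏ₚ fₚ(mₚt + φₚ + iamₚ)` (`|a mₚ| < ε`);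
  `norm_integral_cexp_mul_prod_le` — **the bound** `≤ e^{-qa + ∑ₚ w(a mₚ)} ∫ |G| ∏ₚ gₚ`;
  `norm_integral_cexp_mul_prod_le_exp_neg_sq` — the optimised quadratic case
  `e^{-q²/(4c ∑ₚ mₚ²)}` (= FS82 (2.64) `e^{-(β/2n_{xy})ρ²}` for `c = 1/2β`, `∑ mₚ² = n_{xy}`);
  `stripTilt` (`ĩ(a; φ)`, (4.12)), `norm_stripTilt_le_one`, and
  `integral_cexp_mul_prod_eq_exp_mul_integral_stripTilt` — (4.15) verbatim.
* `isStripWeight_gaussian` (Villain: `ε` arbitrary, `w(y) = y²/2β`), `sum_penalty_incidence`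
  (`∑ₚ w(a Mₚ) = n · w(a)` for incidence numbers `Mₚ ∈ {0, ±1}`). The Wilson instance
  (`ε = β/2`, `w = O((y² + e^{2π|y|})/β)`, `β ≥ 100`, from `BesselIDebyeStrip`) is the companion
  file `ComplexTranslationBessel.lean`.
* The lattice form on `ℝ^E`: `splitAt e₀ : ℝ^E ≃ᵐ ℝ × ℝ^{E∖{e₀}}` (volume preserving,
  `volume_preserving_splitAt(_symm)`), `integral_cexp_mul_prod_eq_exp_mul_integral_translate_pi`
  and `norm_integral_cexp_mul_prod_le_pi` for `∫_{ℝ^E} e^{iqα_{e₀}} G(α) ∏ₚ fₚ((Mα)ₚ) dα` with `G`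
  invariant under changing `α_{e₀}` (`Function.update`), `(Mα)ₚ = ∑ₑ Mₚₑ αₑ` (e.g. `M = d` on the
  gauge-fixed links, `∑ₚ w(aM_{pe₀}) = n_{xy} w(a)`).

* `integral_cexp_sum_mul_finsetProd_eq_exp_mul_integral_translate`,
  `norm_integral_cexp_sum_mul_finsetProd_le` — the lemma ITERATED over a finite set `B` of
  coordinates no two of which are seen by a common factor (FS82 (2.61): the links of `𝔅_ρ`), with
  link-dependent charges and shifts: bound `e^{-∑_B qₑaₑ + ∑ₚ∑_B w(aₑM_{pe})}` ((2.69)–(2.70)).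
* `integrable_prod_of_injective_of_le_exp` — finiteness of the configuration integral after gauge
  fixing: `α ↦ ∏ₚ gₚ((Mα)ₚ)` is integrable on `ℝ^ι` when `α ↦ Mα` is injective and
  `0 ≤ gₚ ≤ C e^{-κ|·|}` (`exp_neg_sq_div_le_exp_neg_abs`; the Bessel weights decay likewise,
  companion file); `integrable_exp_neg_mul_norm_pi`.
* `integral_eq_integral_reIm_of_differentiableOn` — translation across a POLY-STRIP by a general
  imaginary vector `iτ` for any `F : ℂ^E → ℂ` holomorphic on `{Im zₑ ∈ [[0, τₑ]]}` with an
  integrable majorant depending on `Re z` only (the form of FS81 Lemma 4.4 (4.36) and Sect. 6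
  (6.4), where translated coordinates share factors); `integral_mul_prod_eq_integral_translate_reIm`
  — its product-weight instance `∫ G(x)∏ₚfₚ((Mx)ₚ) = ∫ G(x+iτ)∏ₚfₚ((M(x+iτ))ₚ)` for `G` holomorphic
  and bounded on the poly-strip and `∑ₑ |M_{pe}τₑ| < ε`.

Design: the translated variable is singled out as the first factor of a product space rather than
by an index, so that the core statements involve no linear algebra; the `ℝ^E` versions are
one-coordinate transports along `splitAt`. Finiteness of the configuration integral is a
hypothesis of the translation lemmas (`hint`; in [FS81] it follows from (4.10)(i) and the boundary
condition, in the gauge models from gauge fixing — `integrable_prod_of_injective_of_le_exp`), as is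
the independence of `G` from the translated variables (or, in the poly-strip form, its
analyticity). Not here: the renormalised densities and activities themselves
([FS82, (2.68)–(2.69), Corollary 4]), the electrostatic estimates on larger scales ([FS81, Lemma 4.4
(4.34)]) and the Sect. 6 change of variables ((6.10)–(6.14)).

## References

* J. Fröhlich, T. Spencer, *The Kosterlitz–Thouless transition in two-dimensional abelian spin
  systems and the Coulomb gas*, Comm. Math. Phys. 81 (1981) 527–602: Sect. 4.2, Condition (4.10),
  (4.11)–(4.12), Lemma 4.3, (4.15)–(4.16) and Remarks 1–2, pp. 553–554; Sect. 6 (a)–(d), p. 576;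
  Appendix B, pp. 597–599. [FrohlichSpencerKT1981]
* J. Fröhlich, T. Spencer, *Massless phases and symmetry restoration in abelian gauge theories
  and spin systems*, Comm. Math. Phys. 83 (1982) 411–454: §2.8 Lemma 3, (2.61)–(2.64), (2.70),
  p. 428–429; p. 433 (Wilson action). [FrohlichSpencerCMP1982]
* [FS81] Lemma 4.4 and (4.36), pp. 556–557 (translation `φ(j) → φ(j) + ia(j)` on a disc).
-/

noncomputable section

open _root_.MeasureTheory _root_.Complex Set Filter Finset
open scoped Topology BigOperators Interval Real

namespace Literature.Probability.LatticeModels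

/-! ### Shifting the line of integration across a strip, under integrability only -/

/-- **Contour shift across a horizontal strip.** Let `F` be complex differentiable on the closed strip
`{Im z ∈ [0, a]}` (resp. `[a, 0]`), integrable on the two boundary lines and integrable on the strip
(with respect to area measure). Then `∫ F(x) dx = ∫ F(x + ia) dx`. No pointwise decay at `Re z → ±∞`
is assumed: the contributions of the vertical sides of the rectangles `[R', R] × [0, a]` are
`≤ ∫₀ᵃ |F(R + is)| ds`, an integrable function of `R`, hence small along suitable `R → +∞`,
`R' → -∞` (Cauchy's theorem on rectangles, `Complex.integral_boundary_rect_eq_zero_of_differentiableOn`).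
[folklore] -/
theorem integral_eq_integral_add_mul_I_of_integrable_strip (F : ℂ → ℂ) (a : ℝ)
    (hd : DifferentiableOn ℂ F (univ ×ℂ uIcc 0 a))
    (h0 : Integrable fun x : ℝ => F x) (h1 : Integrable fun x : ℝ => F (x + a * I))
    (h2 : Integrable (fun z : ℝ × ℝ => F (z.1 + z.2 * I))
      ((volume : Measure ℝ).prod (volume.restrict (uIcc 0 a)))) :
    ∫ x : ℝ, F x = ∫ x : ℝ, F (x + a * I) := by
  -- the vertical-side majorant `W R = ∫_{[0,a]} |F(R + is)| ds` is integrable in `R`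
  set W : ℝ → ℝ := fun R => ∫ s in uIcc 0 a, ‖F (R + s * I)‖ with hW
  have hWi : Integrable W := h2.integral_norm_prod_left
  have hWnn : ∀ R, 0 ≤ W R := fun R => integral_nonneg fun _ => norm_nonneg _
  have hfin : ∀ δ : ℝ, 0 < δ → volume {x : ℝ | δ ≤ ‖W x‖} < ⊤ := fun δ hδ =>
    hWi.measure_norm_ge_lt_top hδ
  have hsmall_top : ∀ δ : ℝ, 0 < δ → ∀ N : ℝ, ∃ R, N ≤ R ∧ W R < δ := by
    intro δ hδ N
    by_contra h
    push Not at h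
    have hsub : Ici N ⊆ {x : ℝ | δ ≤ ‖W x‖} := fun R hR => by
      simp only [mem_setOf_eq, Real.norm_of_nonneg (hWnn R)]
      exact h R hR
    have := (measure_mono hsub).trans_lt (hfin δ hδ)
    simp at this
  have hsmall_bot : ∀ δ : ℝ, 0 < δ → ∀ N : ℝ, ∃ R, R ≤ N ∧ W R < δ := by
    intro δ hδ N
    by_contra h
    push Not at h
    have hsub : Iic N ⊆ {x : ℝ | δ ≤ ‖W x‖} := fun R hR => by
      simp only [mem_setOf_eq, Real.norm_of_nonneg (hWnn R)]
      exact h R hR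
    have := (measure_mono hsub).trans_lt (hfin δ hδ)
    simp at this
  -- continuity on the strip, vertical integrals bounded by `W`
  have hcont : ContinuousOn F (univ ×ℂ uIcc 0 a) := hd.continuousOn
  have hvc : ∀ R : ℝ, ContinuousOn (fun s : ℝ => F (R + s * I)) (uIcc 0 a) := by
    intro R
    refine hcont.comp (by fun_prop) fun s hs => ?_
    simpa [Complex.mem_reProdIm] using hs
  have hvert : ∀ R : ℝ, ‖∫ s in (0 : ℝ)..a, F (R + s * I)‖ ≤ W R := by
    intro R
    rw [intervalIntegral.norm_intervalIntegral_eq]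
    calc ‖∫ s in Ι 0 a, F (R + s * I)‖ ≤ ∫ s in Ι 0 a, ‖F (R + s * I)‖ :=
          norm_integral_le_integral_norm _
      _ ≤ ∫ s in uIcc 0 a, ‖F (R + s * I)‖ := by
          refine setIntegral_mono_set ?_ (ae_of_all _ fun _ => norm_nonneg _)
            (ae_of_all _ uIoc_subset_uIcc)
          exact ((hvc R).norm.integrableOn_compact isCompact_uIcc)
  -- Cauchy on the rectangles `[R', R] × [0, a]`
  have hrect : ∀ R' R : ℝ, (∫ x in R'..R, F x) - (∫ x in R'..R, F (x + a * I)) +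
      I • (∫ y in (0 : ℝ)..a, F (R + y * I)) - I • (∫ y in (0 : ℝ)..a, F (R' + y * I)) = 0 := by
    intro R' R
    have h := Complex.integral_boundary_rect_eq_zero_of_differentiableOn F (R' : ℂ) (R + a * I)
      (hd.mono fun z hz => ⟨mem_univ _, by simpa [Complex.mem_reProdIm] using hz.2⟩)
    simpa using h
  -- the truncated integrals converge
  have hT : Tendsto (fun p : ℝ × ℝ => ∫ x in p.1..p.2, F x) (atBot ×ˢ atTop) (𝓝 (∫ x : ℝ, F x)) :=
    intervalIntegral_tendsto_integral h0 tendsto_fst tendsto_snd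
  have hTa : Tendsto (fun p : ℝ × ℝ => ∫ x in p.1..p.2, F (x + a * I)) (atBot ×ˢ atTop)
      (𝓝 (∫ x : ℝ, F (x + a * I))) :=
    intervalIntegral_tendsto_integral h1 tendsto_fst tendsto_snd
  -- conclusion: the difference is smaller than `4δ` for every `δ > 0`
  set L := ∫ x : ℝ, F x with hL
  set La := ∫ x : ℝ, F (x + a * I) with hLa
  have key : ∀ δ : ℝ, 0 < δ → ‖L - La‖ ≤ 4 * δ := by
    intro δ hδ
    have hev := ((Metric.tendsto_nhds.1 hT) δ hδ).and ((Metric.tendsto_nhds.1 hTa) δ hδ)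
    obtain ⟨⟨i, j⟩, -, hij⟩ := (atBot_basis.prod atTop_basis).eventually_iff.1 hev
    obtain ⟨R, hR, hWR⟩ := hsmall_top δ hδ j
    obtain ⟨R', hR', hWR'⟩ := hsmall_bot δ hδ i
    have hmem : ((R', R) : ℝ × ℝ) ∈ Iic i ×ˢ Ici j := ⟨hR', hR⟩
    obtain ⟨hd1, hd2⟩ := hij hmem
    simp only [dist_eq_norm] at hd1 hd2
    have hid : L - La = (L - ∫ x in R'..R, F x) + ((∫ x in R'..R, F (x + a * I)) - La)
        - I • (∫ y in (0 : ℝ)..a, F (R + y * I)) + I • (∫ y in (0 : ℝ)..a, F (R' + y * I)) := by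
      linear_combination hrect R' R
    have e1 : ‖L - ∫ x in R'..R, F x‖ ≤ δ := by rw [norm_sub_rev]; exact hd1.le
    have e2 : ‖(∫ x in R'..R, F (x + a * I)) - La‖ ≤ δ := hd2.le
    have e3 : ‖I • (∫ y in (0 : ℝ)..a, F (R + y * I))‖ ≤ W R := by
      rw [norm_smul, Complex.norm_I, one_mul]; exact hvert R
    have e4 : ‖I • (∫ y in (0 : ℝ)..a, F (R' + y * I))‖ ≤ W R' := by
      rw [norm_smul, Complex.norm_I, one_mul]; exact hvert R'
    rw [hid]
    have t1 := norm_add_le ((L - ∫ x in R'..R, F x) + ((∫ x in R'..R, F (x + a * I)) - La)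
        - I • (∫ y in (0 : ℝ)..a, F (R + y * I))) (I • (∫ y in (0 : ℝ)..a, F (R' + y * I)))
    have t2 := norm_sub_le ((L - ∫ x in R'..R, F x) + ((∫ x in R'..R, F (x + a * I)) - La))
        (I • (∫ y in (0 : ℝ)..a, F (R + y * I)))
    have t3 := norm_add_le (L - ∫ x in R'..R, F x) ((∫ x in R'..R, F (x + a * I)) - La)
    linarith
  have h0' : ‖L - La‖ ≤ 0 := by
    by_contra h
    push Not at h
    have := key (‖L - La‖ / 8) (by positivity)
    linarith
  exact sub_eq_zero.1 (norm_le_zero_iff.1 h0')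

/-! ### Weights analytic in a strip: Fröhlich–Spencer's Condition (4.10) -/

/-- **Fröhlich–Spencer's Condition (4.10)** on a single (plaquette / bond) weight, in the form used by
the complex translation lemma: `g : ℝ → ℝ` is the positive weight on the real axis and `f : ℂ → ℂ`
its analytic continuation to the open strip `Σ_ε = {|Im z| < ε}`, with the ratio bound
`|f(x + iy)| ≤ e^{c y²} g(x)` (`|y| < ε`). FS81 state it as: (i) `I_β` even, positive, integrable on
`ℝ`; (ii) `I_β` analytic in `Σ_ε`; (iii) `|I_β(φ + ia)/I_β(φ)| ≤ e^{c(β)a²}` for `|a| < ε`. Evenness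
and integrability are not used by Lemma 4.3 and are not recorded here (the finiteness of the
configuration integral enters the lemma directly as a hypothesis). The Gaussian `e^{-φ²/2β}`
satisfies it with `ε = ∞`, `c = 1/2β` (`isStripWeight_gaussian`); Fröhlich–Spencer's analytic
interpolation of the Bessel coefficients `I_n(β)` of the cosine (Wilson) weight satisfies it with
`ε = β/2` and a penalty `O((y² + e^{2π|y|})/β)` (`BesselIDebyeStrip`, FS81 Appendix B; companion
file `ComplexTranslationBessel.lean`).
[cite: FrohlichSpencerKT1981, Sect. 4.2, Condition (4.10), p. 553] -/
structure IsStripWeight (ε : ℝ) (w : ℝ → ℝ) (g : ℝ → ℝ) (f : ℂ → ℂ) : Prop where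
  /-- (ii) `f` is complex differentiable on the open strip `|Im z| < ε`. -/
  differentiableOn : DifferentiableOn ℂ f {z : ℂ | |z.im| < ε}
  /-- `f` restricts to `g` on the real axis. -/
  ofReal_eq : ∀ x : ℝ, f x = g x
  /-- (i) the weight is positive on the real axis. -/
  pos : ∀ x : ℝ, 0 < g x
  /-- (iii) the ratio bound `|f(x + iy)| ≤ e^{w(y)} g(x)` for `|y| < ε`. -/
  norm_le : ∀ x y : ℝ, |y| < ε → ‖f (x + y * I)‖ ≤ Real.exp (w y) * g x
  /-- the penalty `w` is a non-decreasing function of `|y|` ... -/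
  mono : ∀ ⦃y y' : ℝ⦄, |y| ≤ |y'| → w y ≤ w y'
  /-- ... and vanishes for the zero shift (as it may, since `f = g` on the real axis). -/
  zero : w 0 = 0

namespace IsStripWeight

variable {ε : ℝ} {w : ℝ → ℝ} {g : ℝ → ℝ} {f : ℂ → ℂ}

/-- The open strip `{|Im z| < ε}` is open. [folklore] -/
theorem isOpen_strip (ε : ℝ) : IsOpen {z : ℂ | |z.im| < ε} :=
  isOpen_lt (continuous_abs.comp Complex.continuous_im) continuous_const

/-- `f` is differentiable at every point of the open strip. [folklore] -/
theorem differentiableAt (h : IsStripWeight ε w g f) {z : ℂ} (hz : |z.im| < ε) :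
    DifferentiableAt ℂ f z :=
  h.differentiableOn.differentiableAt ((isOpen_strip ε).mem_nhds hz)

/-- The restriction of `f` to a horizontal line `Im z = b` inside the strip is continuous.
[folklore] -/
theorem continuous_line (h : IsStripWeight ε w g f) {b : ℝ} (hb : |b| < ε) :
    Continuous fun x : ℝ => f (x + b * I) := by
  have hc : ContinuousOn f {z : ℂ | |z.im| < ε} := h.differentiableOn.continuousOn
  exact hc.comp_continuous (by fun_prop) fun x => by simpa using hb

/-- The restriction of `f` to the real axis is continuous (`ε > 0`). [folklore] -/
theorem continuous_ofReal (h : IsStripWeight ε w g f) (hε : 0 < ε) :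
    Continuous fun x : ℝ => f x := by
  simpa using h.continuous_line (b := 0) (by simpa using hε)

/-- The real weight `g` is continuous (`ε > 0`). [folklore] -/
theorem continuous (h : IsStripWeight ε w g f) (hε : 0 < ε) : Continuous g := by
  have h1 : Continuous fun x : ℝ => (f x).re := Complex.continuous_re.comp (h.continuous_ofReal hε)
  refine h1.congr fun x => ?_
  rw [h.ofReal_eq]; simp

/-- On the real axis `‖f x‖ = g x`. [folklore] -/
theorem norm_ofReal (h : IsStripWeight ε w g f) (x : ℝ) : ‖f x‖ = g x := by
  rw [h.ofReal_eq, Complex.norm_real, Real.norm_of_nonneg (h.pos x).le]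

/-- The ratio bound, uniformly on `|y| ≤ |a|`: `‖f(x + iy)‖ ≤ e^{w(a)} g(x)` (`|y| < ε`).
[folklore] -/
theorem norm_le_of_abs_le (h : IsStripWeight ε w g f) (x : ℝ) {y a : ℝ} (hy : |y| < ε)
    (hya : |y| ≤ |a|) : ‖f (x + y * I)‖ ≤ Real.exp (w a) * g x :=
  (h.norm_le x y hy).trans (mul_le_mul_of_nonneg_right (Real.exp_le_exp.2 (h.mono hya)) (h.pos x).le)

/-- The penalty is an even function. [folklore] -/
theorem penalty_neg (h : IsStripWeight ε w g f) (y : ℝ) : w (-y) = w y :=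
  le_antisymm (h.mono (by rw [abs_neg])) (h.mono (by rw [abs_neg]))

/-- The penalty is non-negative. [folklore] -/
theorem penalty_nonneg (h : IsStripWeight ε w g f) (y : ℝ) : 0 ≤ w y := by
  rw [← h.zero]; exact h.mono (by simp)

end IsStripWeight

/-- Membership in `[[0, a]]` bounds the absolute value by `|a|`. [folklore] -/
theorem abs_le_abs_of_mem_uIcc_zero {s a : ℝ} (hs : s ∈ uIcc (0 : ℝ) a) : |s| ≤ |a| := by
  rcases mem_uIcc.1 hs with ⟨h1, h2⟩ | ⟨h1, h2⟩
  · rw [abs_of_nonneg h1]; exact h2.trans (le_abs_self a)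
  · rw [abs_of_nonpos h2, ← abs_neg a]; exact (neg_le_neg h1).trans (le_abs_self (-a))

/-! ### The complex translation lemma on a product space `ℝ × Y` -/

section Core

variable {Y : Type*} [MeasurableSpace Y] {ν : Measure Y} [SFinite ν]
variable {P : Type*} [Fintype P]
variable {ε : ℝ} {w : ℝ → ℝ} {g : P → ℝ → ℝ} {f : P → ℂ → ℂ}

/-- **Fröhlich–Spencer's complex translation lemma, identity form** (FS81 Lemma 4.3; FS82 Lemma 3).
Coordinates: the translated variable `t ∈ ℝ` (the dual field `φ(j₀)` at one site, resp. `α_{xy}` on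
one link) and all the other variables `y ∈ Y` (any s-finite measure space). The weight is a finite
product `∏ₚ fₚ(mₚ t + φₚ(y))` of strip weights (`IsStripWeight ε w`) evaluated on real affine
functions of `t` (coefficient `mₚ`, e.g. the incidence number `∈ {0, ±1}` of the link in the
plaquette `p`) times an arbitrary factor `G(y)` NOT depending on `t`, times the character
`e^{iqt}`. If the configuration integral converges absolutely (`hint`) and the shifts stay in the
strip (`|a mₚ| < ε`), then translating `t ↦ t + ia`:
`∫ e^{iqt} G ∏ₚ fₚ(mₚt + φₚ) = e^{-qa} ∫ e^{iqt} G ∏ₚ fₚ(mₚt + φₚ + i a mₚ)`.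
Proof: Fubini and the one-variable contour shift
`integral_eq_integral_add_mul_I_of_integrable_strip` for a.e. `y`.
[cite: FrohlichSpencerKT1981, Lemma 4.3 with (4.15), p. 554]
[cite: FrohlichSpencerCMP1982, Lemma 3, (2.63), p. 428] -/
theorem integral_cexp_mul_prod_eq_exp_mul_integral_translate
    (hw : ∀ p, IsStripWeight ε w (g p) (f p)) (m : P → ℝ) {φ : P → Y → ℝ}
    (hφ : ∀ p, Measurable (φ p)) {G : Y → ℂ} (hG : AEStronglyMeasurable G ν) (q : ℝ) {a : ℝ}
    (ha : ∀ p, |a * m p| < ε)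
    (hint : Integrable (fun z : ℝ × Y => ‖G z.2‖ * ∏ p, g p (m p * z.1 + φ p z.2)) (volume.prod ν)) :
    ∫ z : ℝ × Y, cexp (I * q * z.1) * G z.2 * ∏ p, f p ((m p * z.1 + φ p z.2 : ℝ) : ℂ) ∂(volume.prod ν)
      = Real.exp (-(q * a)) * ∫ z : ℝ × Y, cexp (I * q * z.1) * G z.2 *
          ∏ p, f p ((m p * z.1 + φ p z.2 : ℝ) + (a * m p : ℝ) * I) ∂(volume.prod ν) := by
  -- the holomorphic function of the translated variable, for fixed `y`
  set Fy : Y → ℂ → ℂ := fun y z => cexp (I * q * z) * G y * ∏ p, f p ((m p : ℂ) * z + (φ p y : ℂ))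
    with hFy_def
  have hFy_shift : ∀ (y : Y) (t s : ℝ), Fy y (t + s * I) =
      cexp (I * q * (t + s * I)) * G y * ∏ p, f p ((m p * t + φ p y : ℝ) + (s * m p : ℝ) * I) := by
    intro y t s
    simp only [hFy_def]
    congr 1
    refine Finset.prod_congr rfl fun p _ => ?_
    congr 1; push_cast; ring
  have hFy_zero : ∀ (y : Y) (t : ℝ), Fy y t =
      cexp (I * q * t) * G y * ∏ p, f p ((m p * t + φ p y : ℝ) : ℂ) := by
    intro y t
    have := hFy_shift y t 0
    simpa using this
  -- differentiability on the closed strip `Im z ∈ [[0, a]]`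
  have hFy_diff : ∀ y, DifferentiableOn ℂ (Fy y) (univ ×ℂ uIcc 0 a) := by
    intro y z hz
    have hzim : |z.im| ≤ |a| := abs_le_abs_of_mem_uIcc_zero ((Complex.mem_reProdIm.1 hz).2)
    apply DifferentiableAt.differentiableWithinAt
    refine (DifferentiableAt.mul (by fun_prop) (differentiableAt_const _)).mul ?_
    refine DifferentiableAt.fun_finsetProd fun p _ => ?_
    refine ((hw p).differentiableAt ?_).comp z (by fun_prop)
    simp only [Complex.add_im, Complex.mul_im, Complex.ofReal_re, Complex.ofReal_im, zero_mul,
      add_zero]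
    calc |m p * z.im| = |m p| * |z.im| := abs_mul _ _
      _ ≤ |m p| * |a| := mul_le_mul_of_nonneg_left hzim (abs_nonneg _)
      _ = |a * m p| := by rw [abs_mul, mul_comm]
      _ < ε := ha p
  -- the uniform bound on the strip
  set K : ℝ × Y → ℝ := fun z => ‖G z.2‖ * ∏ p, g p (m p * z.1 + φ p z.2) with hK_def
  set C : ℝ := Real.exp (|q| * |a|) * Real.exp (∑ p, w (a * m p)) with hC_def
  have hK_nonneg : ∀ z, 0 ≤ K z := fun z =>
    mul_nonneg (norm_nonneg _) (Finset.prod_nonneg fun p _ => ((hw p).pos _).le)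
  have hsm : ∀ (s : ℝ), s ∈ uIcc (0 : ℝ) a → ∀ p, |s * m p| < ε := by
    intro s hs p
    calc |s * m p| = |s| * |m p| := abs_mul _ _
      _ ≤ |a| * |m p| := mul_le_mul_of_nonneg_right (abs_le_abs_of_mem_uIcc_zero hs) (abs_nonneg _)
      _ = |a * m p| := (abs_mul _ _).symm
      _ < ε := ha p
  have hnorm : ∀ (y : Y) (t s : ℝ), s ∈ uIcc (0 : ℝ) a → ‖Fy y (t + s * I)‖ ≤ C * K (t, y) := by
    intro y t s hs
    rw [hFy_shift, norm_mul, norm_mul, Complex.norm_exp]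
    have hre : (I * q * (t + s * I)).re = -(q * s) := by
      simp [Complex.mul_re, Complex.mul_im]
    rw [hre]
    have h1 : Real.exp (-(q * s)) ≤ Real.exp (|q| * |a|) := by
      refine Real.exp_le_exp.2 ?_
      calc -(q * s) ≤ |q * s| := neg_le_abs _
        _ = |q| * |s| := abs_mul _ _
        _ ≤ |q| * |a| := mul_le_mul_of_nonneg_left (abs_le_abs_of_mem_uIcc_zero hs) (abs_nonneg _)
    have h2 : ‖∏ p, f p ((m p * t + φ p y : ℝ) + (s * m p : ℝ) * I)‖ ≤
        Real.exp (∑ p, w (a * m p)) * ∏ p, g p (m p * t + φ p y) := by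
      rw [norm_prod, Real.exp_sum, ← Finset.prod_mul_distrib]
      refine Finset.prod_le_prod (fun p _ => norm_nonneg _) fun p _ => ?_
      have hya : |s * m p| ≤ |a * m p| := by
        rw [abs_mul, abs_mul]
        exact mul_le_mul_of_nonneg_right (abs_le_abs_of_mem_uIcc_zero hs) (abs_nonneg _)
      exact (hw p).norm_le_of_abs_le (m p * t + φ p y) (hsm s hs p) hya
    calc Real.exp (-(q * s)) * ‖G y‖ * ‖∏ p, f p ((m p * t + φ p y : ℝ) + (s * m p : ℝ) * I)‖
        ≤ Real.exp (|q| * |a|) * ‖G y‖ *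
          (Real.exp (∑ p, w (a * m p)) * ∏ p, g p (m p * t + φ p y)) := by
          gcongr
      _ = C * K (t, y) := by simp only [hC_def, hK_def]; ring
  -- measurability and integrability of the integrands on the lines `Im = s`, `s ∈ [[0, a]]`
  have hmeas : ∀ (s : ℝ), s ∈ uIcc (0 : ℝ) a →
      AEStronglyMeasurable (fun z : ℝ × Y => Fy z.2 (z.1 + s * I)) (volume.prod ν) := by
    intro s hs
    have hfun : (fun z : ℝ × Y => Fy z.2 (z.1 + s * I)) = fun z =>
        cexp (I * q * (z.1 + s * I)) * G z.2 * ∏ p, f p ((m p * z.1 + φ p z.2 : ℝ) + (s * m p : ℝ) * I) :=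
      funext fun z => hFy_shift z.2 z.1 s
    rw [hfun]
    refine AEStronglyMeasurable.mul (AEStronglyMeasurable.mul ?_ hG.comp_snd) ?_
    · have hc : Continuous fun t : ℝ => cexp (I * q * (t + s * I)) := by fun_prop
      exact hc.aestronglyMeasurable.comp_fst
    · refine Finset.aestronglyMeasurable_fun_prod _ fun p _ => ?_
      have hl := ((hw p).continuous_line (hsm s hs p)).measurable
      have hi : Measurable fun z : ℝ × Y => m p * z.1 + φ p z.2 :=
        (measurable_const.mul measurable_fst).add ((hφ p).comp measurable_snd)
      exact (hl.comp hi).aestronglyMeasurable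
  have hInt : ∀ (s : ℝ), s ∈ uIcc (0 : ℝ) a →
      Integrable (fun z : ℝ × Y => Fy z.2 (z.1 + s * I)) (volume.prod ν) := fun s hs =>
    (hint.const_mul C).mono' (hmeas s hs) (ae_of_all _ fun z => hnorm z.2 z.1 s hs)
  -- the one-variable contour shift, for a.e. `y`
  have hKy : ∀ᵐ y ∂ν, Integrable (fun t : ℝ => K (t, y)) := hint.prod_left_ae
  have hμ : ((volume : Measure ℝ).prod (volume.restrict (uIcc (0 : ℝ) a))) =
      ((volume : Measure ℝ).prod (volume : Measure ℝ)).restrict (univ ×ˢ uIcc (0 : ℝ) a) := by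
    rw [← Measure.prod_restrict, Measure.restrict_univ]
  have hae : ∀ᵐ y ∂ν, ∫ t : ℝ, Fy y t = ∫ t : ℝ, Fy y (t + a * I) := by
    filter_upwards [hKy] with y hy
    have hKyC : Integrable (fun t : ℝ => C * K (t, y)) := hy.const_mul C
    have hcont : ContinuousOn (Fy y) (univ ×ℂ uIcc 0 a) := (hFy_diff y).continuousOn
    apply integral_eq_integral_add_mul_I_of_integrable_strip (Fy y) a (hFy_diff y)
    · refine hKyC.mono' ?_ (ae_of_all _ fun t => ?_)
      · refine (hcont.comp_continuous continuous_ofReal fun t => ?_).aestronglyMeasurable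
        simp [Complex.mem_reProdIm]
      · simpa using hnorm y t 0 left_mem_uIcc
    · refine hKyC.mono' ?_ (ae_of_all _ fun t => hnorm y t a right_mem_uIcc)
      refine (hcont.comp_continuous (by fun_prop) fun t => ?_).aestronglyMeasurable
      simp [Complex.mem_reProdIm]
    · rw [hμ]
      refine Integrable.mono' (g := fun z : ℝ × ℝ => C * K (z.1, y)) ?_ ?_ ?_
      · rw [← hμ]
        have h1 : Integrable (fun _ : ℝ => (1 : ℝ)) (volume.restrict (uIcc (0 : ℝ) a)) :=
          (continuous_const.integrableOn_uIcc : IntegrableOn (fun _ : ℝ => (1 : ℝ)) (uIcc 0 a) volume)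
        simpa using hKyC.mul_prod h1
      · refine ContinuousOn.aestronglyMeasurable ?_ (MeasurableSet.univ.prod measurableSet_uIcc)
        refine hcont.comp (by fun_prop) fun z hz => ?_
        simpa [Complex.mem_reProdIm] using hz
      · filter_upwards [ae_restrict_mem (MeasurableSet.univ.prod measurableSet_uIcc)] with z hz
        exact hnorm y z.1 z.2 hz.2
  -- Fubini
  have hexp : ∀ t : ℝ, cexp (I * q * (t + a * I)) = (Real.exp (-(q * a)) : ℂ) * cexp (I * q * t) := by
    intro t
    rw [Complex.ofReal_exp, ← Complex.exp_add]
    congr 1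
    push_cast
    linear_combination (q * a : ℂ) * I_mul_I
  calc ∫ z : ℝ × Y, cexp (I * q * z.1) * G z.2 * ∏ p, f p ((m p * z.1 + φ p z.2 : ℝ) : ℂ) ∂(volume.prod ν)
      = ∫ z : ℝ × Y, Fy z.2 (z.1 + (0 : ℝ) * I) ∂(volume.prod ν) := by
        refine integral_congr_ae (ae_of_all _ fun z => ?_)
        simp only [Complex.ofReal_zero, zero_mul, add_zero, hFy_zero]
    _ = ∫ y, (∫ t : ℝ, Fy y (t + (0 : ℝ) * I)) ∂ν := integral_prod_symm _ (hInt 0 left_mem_uIcc)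
    _ = ∫ y, (∫ t : ℝ, Fy y (t + a * I)) ∂ν := by
        refine integral_congr_ae ?_
        filter_upwards [hae] with y hy
        simpa using hy
    _ = ∫ z : ℝ × Y, Fy z.2 (z.1 + a * I) ∂(volume.prod ν) := (integral_prod_symm _ (hInt a right_mem_uIcc)).symm
    _ = Real.exp (-(q * a)) * ∫ z : ℝ × Y, cexp (I * q * z.1) * G z.2 *
          ∏ p, f p ((m p * z.1 + φ p z.2 : ℝ) + (a * m p : ℝ) * I) ∂(volume.prod ν) := by
        rw [← integral_const_mul]
        refine integral_congr_ae (ae_of_all _ fun z => ?_)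
        dsimp only
        rw [hFy_shift, hexp]
        simp only [mul_comm a]
        ring

/-- **Fröhlich–Spencer's complex translation lemma, bound form**: under the hypotheses of
`integral_cexp_mul_prod_eq_exp_mul_integral_translate`,
`|∫ e^{iqt} G ∏ₚ fₚ(mₚt + φₚ)| ≤ e^{-qa + ∑ₚ w(a mₚ)} ∫ |G| ∏ₚ gₚ(mₚt + φₚ)`: the character
`e^{iqt}` gains `e^{-qa}`, each factor through which the translated variable runs costs
`e^{w(a mₚ)}` by Condition (4.10)(iii) (`= e^{c(β)a²}` per factor for the quadratic penalty, i.e.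
`e^{-qa + 4c(β)a²}` at a site of `ℤ²`, FS81 (4.15)). For the Gaussian (`w(y) = y²/2β`,
`∑ₚ mₚ² = n_{xy}`) this is the factor `e^{-(β/2n_{xy})ρ²}` of FS82 (2.63)–(2.64) after optimising
`a` (`norm_integral_cexp_mul_prod_le_exp_neg_sq`).
[cite: FrohlichSpencerKT1981, Lemma 4.3, (4.15)–(4.16), p. 554]
[cite: FrohlichSpencerCMP1982, Lemma 3 and (2.64), p. 428] -/
theorem norm_integral_cexp_mul_prod_le
    (hw : ∀ p, IsStripWeight ε w (g p) (f p)) (m : P → ℝ) {φ : P → Y → ℝ}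
    (hφ : ∀ p, Measurable (φ p)) {G : Y → ℂ} (hG : AEStronglyMeasurable G ν) (q : ℝ) {a : ℝ}
    (ha : ∀ p, |a * m p| < ε)
    (hint : Integrable (fun z : ℝ × Y => ‖G z.2‖ * ∏ p, g p (m p * z.1 + φ p z.2)) (volume.prod ν)) :
    ‖∫ z : ℝ × Y, cexp (I * q * z.1) * G z.2 * ∏ p, f p ((m p * z.1 + φ p z.2 : ℝ) : ℂ) ∂(volume.prod ν)‖
      ≤ Real.exp (-(q * a) + ∑ p, w (a * m p)) *
          ∫ z : ℝ × Y, ‖G z.2‖ * ∏ p, g p (m p * z.1 + φ p z.2) ∂(volume.prod ν) := by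
  rw [integral_cexp_mul_prod_eq_exp_mul_integral_translate hw m hφ hG q ha hint, norm_mul,
    Complex.norm_real, Real.norm_eq_abs, Real.abs_exp, Real.exp_add, mul_assoc]
  refine mul_le_mul_of_nonneg_left ?_ (Real.exp_pos _).le
  rw [← integral_const_mul]
  refine norm_integral_le_of_norm_le (hint.const_mul _) (ae_of_all _ fun z => ?_)
  rw [norm_mul, norm_mul, Complex.norm_exp]
  have hre : (I * q * (z.1 : ℂ)).re = 0 := by simp [Complex.mul_re, Complex.mul_im]
  rw [hre, Real.exp_zero, one_mul, norm_prod, Real.exp_sum, mul_left_comm, ← Finset.prod_mul_distrib]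
  refine mul_le_mul_of_nonneg_left ?_ (norm_nonneg _)
  exact Finset.prod_le_prod (fun p _ => norm_nonneg _) fun p _ =>
    (hw p).norm_le (m p * z.1 + φ p z.2) (a * m p) (ha p)

/-- **Optimised bound for the quadratic penalty `w(y) = c y²`** (FS81 Remark 1 after Lemma 4.3,
(4.16); FS82 (2.64)): for `c > 0` and `S = ∑ₚ mₚ² > 0`, choosing `a = q/(2cS)` (admissible when
`|q mₚ|/(2cS) < ε` for all `p`) gives `|∫ e^{iqt} G ∏ₚ fₚ| ≤ e^{-q²/(4cS)} ∫ |G| ∏ₚ gₚ`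
(`E(β, q) = max_a {qa - 4c(β)a²} = q²/16c(β)` for the four bonds at a site of `ℤ²`). With the
Gaussian dual weight of the Villain model (`c = 1/2β`, `ε = ∞`, `S = n_{xy} = 6` in four
dimensions) this is exactly the activity suppression `e^{-(β/2n_{xy})ρ²_{xy}}` of FS82 Lemma 3.
[cite: FrohlichSpencerKT1981, (4.16), p. 554] [cite: FrohlichSpencerCMP1982, (2.64), p. 428] -/
theorem norm_integral_cexp_mul_prod_le_exp_neg_sq {c : ℝ}
    (hw : ∀ p, IsStripWeight ε (fun y => c * y ^ 2) (g p) (f p)) (m : P → ℝ) {φ : P → Y → ℝ}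
    (hφ : ∀ p, Measurable (φ p)) {G : Y → ℂ} (hG : AEStronglyMeasurable G ν) (q : ℝ)
    (hc : 0 < c) (hS : 0 < ∑ p, m p ^ 2)
    (ha : ∀ p, |q / (2 * c * ∑ p, m p ^ 2) * m p| < ε)
    (hint : Integrable (fun z : ℝ × Y => ‖G z.2‖ * ∏ p, g p (m p * z.1 + φ p z.2)) (volume.prod ν)) :
    ‖∫ z : ℝ × Y, cexp (I * q * z.1) * G z.2 * ∏ p, f p ((m p * z.1 + φ p z.2 : ℝ) : ℂ) ∂(volume.prod ν)‖
      ≤ Real.exp (-(q ^ 2 / (4 * c * ∑ p, m p ^ 2))) *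
          ∫ z : ℝ × Y, ‖G z.2‖ * ∏ p, g p (m p * z.1 + φ p z.2) ∂(volume.prod ν) := by
  have h := norm_integral_cexp_mul_prod_le hw m hφ hG q ha hint
  have hsum : ∀ a' : ℝ, ∑ p, c * (a' * m p) ^ 2 = c * a' ^ 2 * ∑ p, m p ^ 2 := fun a' => by
    rw [Finset.mul_sum]
    exact Finset.sum_congr rfl fun p _ => by ring
  rw [hsum (q / (2 * c * ∑ p, m p ^ 2))] at h
  convert h using 3
  field_simp
  ring

end Core

/-! ### The renormalised weights `ĩ(a; φ) = f(φ + ia)/(e^{w(a)} g(φ))` and FS81 (4.15) verbatim -/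

section Tilt

variable {ε : ℝ} {w : ℝ → ℝ} {g : ℝ → ℝ} {f : ℂ → ℂ}

/-- Fröhlich–Spencer's renormalised (complex) weight `ĩ_β(a; φ) = I_β(φ + ia)/(I_β(φ) e^{c(β)a²})`
((4.12); here with the general penalty `e^{w(a)}`), of modulus `≤ 1` by Condition (4.10)(iii).
[cite: FrohlichSpencerKT1981, (4.12), p. 553] -/
def stripTilt (w : ℝ → ℝ) (g : ℝ → ℝ) (f : ℂ → ℂ) (a φ : ℝ) : ℂ :=
  f (φ + a * I) / ((Real.exp (w a) * g φ : ℝ) : ℂ)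

/-- `|ĩ(a; φ)| ≤ 1` for `|a| < ε`. [cite: FrohlichSpencerKT1981, after (4.12), p. 553] -/
theorem norm_stripTilt_le_one (h : IsStripWeight ε w g f) {a : ℝ} (ha : |a| < ε) (φ : ℝ) :
    ‖stripTilt w g f a φ‖ ≤ 1 := by
  have hpos : 0 < Real.exp (w a) * g φ := mul_pos (Real.exp_pos _) (h.pos φ)
  rw [stripTilt, norm_div, Complex.norm_real, Real.norm_of_nonneg hpos.le, div_le_one hpos]
  exact h.norm_le φ a ha

/-- `f(φ + ia) = ĩ(a; φ) · e^{w(a)} g(φ)`. [cite: FrohlichSpencerKT1981, (4.12), p. 553] -/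
theorem apply_add_mul_I_eq_stripTilt_mul (h : IsStripWeight ε w g f) (a φ : ℝ) :
    f (φ + a * I) = stripTilt w g f a φ * ((Real.exp (w a) * g φ : ℝ) : ℂ) := by
  have hpos : 0 < Real.exp (w a) * g φ := mul_pos (Real.exp_pos _) (h.pos φ)
  rw [stripTilt, div_mul_cancel₀]
  exact_mod_cast hpos.ne'

variable {Y : Type*} [MeasurableSpace Y] {ν : Measure Y} [SFinite ν]
variable {P : Type*} [Fintype P] {gs : P → ℝ → ℝ} {fs : P → ℂ → ℂ}

/-- **FS81 Lemma 4.3 in its printed form (4.15)**: the translation by `ia` renormalises the weight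
of every factor containing the translated variable by the complex weight `ĩₚ(a mₚ; ·)` of modulus
`≤ 1` and produces the explicit prefactor `e^{-qa + ∑ₚ w(a mₚ)}`
(`e^{-qa + 4c(β)a²}` for the four bonds at a site of `ℤ²` and `w = c(β)(·)²`; `n_{xy} = 6`
plaquettes at a link of `ℤ⁴`):
`∫ e^{iqt} G ∏ₚ fₚ(mₚt + φₚ) = e^{-qa + ∑ w(a mₚ)} ∫ e^{iqt} G ∏ₚ ĩₚ(a mₚ; mₚt + φₚ) gₚ(mₚt + φₚ)`.
[cite: FrohlichSpencerKT1981, Lemma 4.3, (4.15), p. 554] -/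
theorem integral_cexp_mul_prod_eq_exp_mul_integral_stripTilt
    (hw : ∀ p, IsStripWeight ε w (gs p) (fs p)) (m : P → ℝ) {φ : P → Y → ℝ}
    (hφ : ∀ p, Measurable (φ p)) {G : Y → ℂ} (hG : AEStronglyMeasurable G ν) (q : ℝ) {a : ℝ}
    (ha : ∀ p, |a * m p| < ε)
    (hint : Integrable (fun z : ℝ × Y => ‖G z.2‖ * ∏ p, gs p (m p * z.1 + φ p z.2)) (volume.prod ν)) :
    ∫ z : ℝ × Y, cexp (I * q * z.1) * G z.2 * ∏ p, fs p ((m p * z.1 + φ p z.2 : ℝ) : ℂ) ∂(volume.prod ν)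
      = Real.exp (-(q * a) + ∑ p, w (a * m p)) * ∫ z : ℝ × Y, cexp (I * q * z.1) * G z.2 *
          ∏ p, (stripTilt w (gs p) (fs p) (a * m p) (m p * z.1 + φ p z.2) *
            (gs p (m p * z.1 + φ p z.2) : ℂ)) ∂(volume.prod ν) := by
  rw [integral_cexp_mul_prod_eq_exp_mul_integral_translate hw m hφ hG q ha hint, Real.exp_add,
    Complex.ofReal_mul, mul_assoc, ← integral_const_mul (Real.exp (∑ p, w (a * m p)) : ℂ)]
  congr 1
  refine integral_congr_ae (ae_of_all _ fun z => ?_)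
  have hprod : ∏ p, fs p ((m p * z.1 + φ p z.2 : ℝ) + (a * m p : ℝ) * I) =
      (Real.exp (∑ p, w (a * m p)) : ℂ) * ∏ p, (stripTilt w (gs p) (fs p) (a * m p)
        (m p * z.1 + φ p z.2) * (gs p (m p * z.1 + φ p z.2) : ℂ)) := by
    rw [Real.exp_sum, Complex.ofReal_prod, ← Finset.prod_mul_distrib]
    refine Finset.prod_congr rfl fun p _ => ?_
    rw [apply_add_mul_I_eq_stripTilt_mul (hw p)]
    push_cast
    ring_nf
  dsimp only
  rw [hprod]
  ring

end Tilt

/-! ### Instances: the Gaussian (Villain) weight -/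

section Gaussian

/-- The Gaussian dual weight of the Villain model, `e^{-φ²/2β}` with its entire continuation
`e^{-z²/2β}`, satisfies Condition (4.10) on every strip with `c(β) = 1/2β` — in fact with equality
`|e^{-(x+iy)²/2β}| = e^{y²/2β} e^{-x²/2β}` ("Clearly, the Gaussian satisfies Condition (4.10), with
`ε = ∞` and `c(β) = 1/2β`"). [cite: FrohlichSpencerKT1981, Remark after (4.11), p. 553] -/
theorem isStripWeight_gaussian {β : ℝ} (hβ : 0 ≤ β) (ε : ℝ) :
    IsStripWeight ε (fun y => y ^ 2 / (2 * β)) (fun φ : ℝ => Real.exp (-(φ ^ 2 / (2 * β))))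
      (fun z : ℂ => cexp (-(z ^ 2 / (2 * β)))) where
  differentiableOn := by fun_prop
  ofReal_eq x := by push_cast; rfl
  pos x := Real.exp_pos _
  norm_le x y _ := by
    rw [Complex.norm_exp, ← Real.exp_add]
    refine le_of_eq ?_
    congr 1
    have h2 : ((2 : ℂ) * β) = ((2 * β : ℝ) : ℂ) := by push_cast; ring
    rw [h2, show (-((x + y * I) ^ 2 / ((2 * β : ℝ) : ℂ))) =
        (((y ^ 2 - x ^ 2) / (2 * β) : ℝ) : ℂ) + ((-(x * y / β) : ℝ) : ℂ) * I by
      field_simp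
      push_cast
      ring_nf
      rw [Complex.I_sq]
      ring]
    rw [Complex.add_re, Complex.ofReal_re, Complex.re_ofReal_mul, Complex.I_re, mul_zero, add_zero]
    ring
  mono y y' h := by
    refine div_le_div_of_nonneg_right ?_ (by positivity)
    simpa only [sq_abs] using pow_le_pow_left₀ (abs_nonneg y) h 2
  zero := by simp

end Gaussian



/-- **Incidence numbers**: if the coefficients of the translated variable are `0, ±1` (as for
`M = d`), then `∑ₚ w(a Mₚ) = n · w(a)` with `n` the number of factors containing it (`n_{xy}` of
FS82 (2.63): `= 6` for a link of `ℤ⁴`; `4` bonds at a site of `ℤ²` in FS81 (4.15)). [folklore] -/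
theorem sum_penalty_incidence {P : Type*} [Fintype P] {w : ℝ → ℝ} (hw0 : w 0 = 0)
    (hwe : ∀ y, w (-y) = w y) (M : P → ℝ) (hM : ∀ p, M p = 0 ∨ M p = 1 ∨ M p = -1) (a : ℝ) :
    ∑ p, w (a * M p) = ((Finset.univ.filter fun p => M p ≠ 0).card : ℝ) * w a := by
  classical
  have hterm : ∀ p, w (a * M p) = if M p ≠ 0 then w a else 0 := by
    intro p
    rcases hM p with h | h | h
    · simp [h, hw0]
    · simp [h]
    · simp [h, hwe]
  simp_rw [hterm]
  rw [Finset.sum_ite, Finset.sum_const_zero, add_zero, Finset.sum_const, nsmul_eq_mul]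

/-! ### The lattice form: translating one coordinate of `ℝ^E` -/

section Pi

variable {E : Type*} [DecidableEq E]

section NoFintype

/-- `{e // e = e₀}` has exactly one element. [folklore] -/
@[reducible] def uniqueSubtypeEq (e₀ : E) : Unique {e : E // e = e₀} where
  default := ⟨e₀, rfl⟩
  uniq x := Subtype.ext x.2

/-- Splitting off the coordinate `e₀`: `ℝ^E ≃ᵐ ℝ × ℝ^{E ∖ {e₀}}`, `α ↦ (α e₀, α|_{e ≠ e₀})`
(`Equiv.funSplitAt` as a measurable equivalence). [folklore] -/
def splitAt (e₀ : E) : (E → ℝ) ≃ᵐ ℝ × ({e : E // e ≠ e₀} → ℝ) where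
  toEquiv := Equiv.funSplitAt e₀ ℝ
  measurable_toFun := by
    refine Measurable.prodMk (measurable_pi_apply e₀) (measurable_pi_lambda _ fun e => ?_)
    exact measurable_pi_apply (e : E)
  measurable_invFun := by
    refine measurable_pi_lambda _ fun e => ?_
    by_cases h : e = e₀
    · subst h
      simpa [Equiv.funSplitAt, Equiv.piSplitAt] using measurable_fst
    · have hm : Measurable fun z : ℝ × ({e : E // e ≠ e₀} → ℝ) => z.2 ⟨e, h⟩ :=
        (measurable_pi_apply _).comp measurable_snd
      simpa [Equiv.funSplitAt, Equiv.piSplitAt, h] using hm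

/-- The inverse of `splitAt`: the `e₀`-coordinate is the first component. [folklore] -/
@[simp] theorem splitAt_symm_apply_self (e₀ : E) (z : ℝ × ({e : E // e ≠ e₀} → ℝ)) :
    (splitAt e₀).symm z e₀ = z.1 := by
  simp [splitAt]

/-- The inverse of `splitAt` on the other coordinates. [folklore] -/
@[simp] theorem splitAt_symm_apply_coe (e₀ : E) (z : ℝ × ({e : E // e ≠ e₀} → ℝ))
    (i : {e : E // e ≠ e₀}) : (splitAt e₀).symm z i = z.2 i := by
  have h : (i : E) ≠ e₀ := i.2
  simp [splitAt, h]

/-- `splitAt` itself. [folklore] -/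
@[simp] theorem splitAt_apply (e₀ : E) (α : E → ℝ) :
    splitAt e₀ α = (α e₀, fun i : {e : E // e ≠ e₀} => α i) := rfl

/-- Changing the first component of the inverse is `Function.update` at `e₀`. [folklore] -/
theorem splitAt_symm_eq_update (e₀ : E) (t : ℝ) (y : {e : E // e ≠ e₀} → ℝ) :
    (splitAt e₀).symm (t, y) = Function.update ((splitAt e₀).symm (0, y)) e₀ t := by
  funext e
  by_cases h : e = e₀
  · subst h; simp
  · rw [Function.update_of_ne h]
    have := splitAt_symm_apply_coe e₀ (t, y) ⟨e, h⟩
    have h0 := splitAt_symm_apply_coe e₀ (0, y) ⟨e, h⟩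
    simp only at this h0
    rw [this, h0]

end NoFintype

variable [Fintype E]

/-- The inverse of `splitAt` carries `dt ⊗ dy` to Lebesgue measure on `ℝ^E` (boxes go to boxes).
[folklore] -/
theorem volume_preserving_splitAt_symm (e₀ : E) :
    MeasurePreserving (splitAt e₀).symm ((volume : Measure ℝ).prod volume) (volume : Measure (E → ℝ)) where
  measurable := (splitAt e₀).symm.measurable
  map_eq := by
    rw [volume_pi]
    refine (Measure.pi_eq fun s hs => ?_).symm
    rw [Measure.map_apply (splitAt e₀).symm.measurable (MeasurableSet.univ_pi hs)]
    have hpre : (splitAt e₀).symm ⁻¹' (Set.pi univ s) =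
        s e₀ ×ˢ (Set.pi univ fun i : {e : E // e ≠ e₀} => s i) := by
      ext z
      simp only [Set.mem_preimage, Set.mem_pi, Set.mem_univ, true_implies, Set.mem_prod]
      constructor
      · intro h
        exact ⟨by simpa using h e₀, fun i => by simpa using h i⟩
      · rintro ⟨h0, h1⟩ e
        by_cases he : e = e₀
        · subst he; simpa using h0
        · have h2 := splitAt_symm_apply_coe e₀ z ⟨e, he⟩
          simp only at h2
          rw [h2]
          exact h1 ⟨e, he⟩
    rw [hpre, Measure.prod_prod, Measure.pi_pi,
      ← Finset.mul_prod_erase Finset.univ (fun e => volume (s e)) (Finset.mem_univ e₀)]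
    congr 1
    rw [Finset.prod_subtype (Finset.univ.erase e₀) (p := fun e => e ≠ e₀) (by simp)]

/-- `splitAt` preserves Lebesgue measure. [folklore] -/
theorem volume_preserving_splitAt (e₀ : E) :
    MeasurePreserving (splitAt e₀) (volume : Measure (E → ℝ)) ((volume : Measure ℝ).prod volume) := by
  simpa using (volume_preserving_splitAt_symm e₀).symm (splitAt e₀).symm

/-- Sums over `E` split at `e₀` along `splitAt`. [folklore] -/
theorem sum_mul_splitAt_symm (e₀ : E) (M : E → ℝ) (z : ℝ × ({e : E // e ≠ e₀} → ℝ)) :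
    ∑ e, M e * (splitAt e₀).symm z e = M e₀ * z.1 + ∑ i : {e : E // e ≠ e₀}, M i * z.2 i := by
  rw [← Finset.add_sum_erase _ _ (Finset.mem_univ e₀), splitAt_symm_apply_self]
  congr 1
  rw [Finset.sum_subtype (Finset.univ.erase e₀) (p := fun e => e ≠ e₀) (by simp)]
  refine Finset.sum_congr rfl fun i _ => ?_
  rw [splitAt_symm_apply_coe]

variable {P : Type*} [Fintype P] {ε : ℝ} {w : ℝ → ℝ} {g : P → ℝ → ℝ} {f : P → ℂ → ℂ}

/-- **The complex translation lemma on `ℝ^E`** (the form in which it is applied to the dual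
`ℤ`-valued models: `E` = links (sites) carrying the real dual field `α`, `P` = plaquettes (bonds)
carrying the weights `fₚ((Mα)ₚ)` of the linear forms `(Mα)ₚ = ∑ₑ Mₚₑ αₑ`, e.g. `M = d`): if `G`
does not depend on the coordinate `α_{e₀}`, the configuration integral converges absolutely and
`|a M_{p e₀}| < ε` for all `p`, then
`∫ e^{iqα_{e₀}} G(α) ∏ₚ fₚ((Mα)ₚ) dα = e^{-qa} ∫ e^{iqα_{e₀}} G(α) ∏ₚ fₚ((Mα)ₚ + i a M_{p e₀}) dα`.
(From `integral_cexp_mul_prod_eq_exp_mul_integral_translate` by splitting off the coordinate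
`e₀`, `splitAt`.)
[cite: FrohlichSpencerKT1981, Lemma 4.3, (4.15), p. 554]
[cite: FrohlichSpencerCMP1982, Lemma 3, (2.63), p. 428] -/
theorem integral_cexp_mul_prod_eq_exp_mul_integral_translate_pi
    (hw : ∀ p, IsStripWeight ε w (g p) (f p)) (e₀ : E) (M : P → E → ℝ)
    {G : (E → ℝ) → ℂ} (hG : Measurable G) (hGe : ∀ α t, G (Function.update α e₀ t) = G α)
    (q : ℝ) {a : ℝ} (ha : ∀ p, |a * M p e₀| < ε)
    (hint : Integrable (fun α : E → ℝ => ‖G α‖ * ∏ p, g p (∑ e, M p e * α e))) :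
    ∫ α : E → ℝ, cexp (I * q * α e₀) * G α * ∏ p, f p ((∑ e, M p e * α e : ℝ) : ℂ)
      = Real.exp (-(q * a)) * ∫ α : E → ℝ, cexp (I * q * α e₀) * G α *
          ∏ p, f p ((∑ e, M p e * α e : ℝ) + (a * M p e₀ : ℝ) * I) := by
  set Ψ := splitAt e₀ with hΨ
  have hmp : MeasurePreserving Ψ.symm ((volume : Measure ℝ).prod volume) volume :=
    volume_preserving_splitAt_symm e₀
  -- the data of the product form
  set φ : P → ({e : E // e ≠ e₀} → ℝ) → ℝ := fun p y => ∑ i : {e : E // e ≠ e₀}, M p i * y i with hφ_def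
  set G' : ({e : E // e ≠ e₀} → ℝ) → ℂ := fun y => G (Ψ.symm (0, y)) with hG'_def
  have hφm : ∀ p, Measurable (φ p) := fun p =>
    Finset.measurable_sum _ fun i _ => (measurable_pi_apply i).const_mul _
  have hG'm : Measurable G' := hG.comp (Ψ.symm.measurable.comp (measurable_const.prodMk measurable_id))
  have hGΨ : ∀ z : ℝ × ({e : E // e ≠ e₀} → ℝ), G (Ψ.symm z) = G' z.2 := by
    rintro ⟨t, y⟩
    simp only [hG'_def]
    rw [hΨ, splitAt_symm_eq_update e₀ t y, hGe]
  have hsum : ∀ (p : P) (z : ℝ × ({e : E // e ≠ e₀} → ℝ)),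
      ∑ e, M p e * Ψ.symm z e = M p e₀ * z.1 + φ p z.2 := fun p z => sum_mul_splitAt_symm e₀ (M p) z
  have hΨ0 : ∀ z : ℝ × ({e : E // e ≠ e₀} → ℝ), Ψ.symm z e₀ = z.1 := fun z =>
    splitAt_symm_apply_self e₀ z
  -- transport the three integrals along `Ψ.symm`
  have hint' : Integrable (fun z : ℝ × ({e : E // e ≠ e₀} → ℝ) =>
      ‖G' z.2‖ * ∏ p, g p (M p e₀ * z.1 + φ p z.2)) ((volume : Measure ℝ).prod volume) := by
    have h := (hmp.integrable_comp_emb Ψ.symm.measurableEmbedding).2 hint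
    refine h.congr (ae_of_all _ fun z => ?_)
    simp only [Function.comp_apply, hGΨ, hsum]
  have hL : ∫ α : E → ℝ, cexp (I * q * α e₀) * G α * ∏ p, f p ((∑ e, M p e * α e : ℝ) : ℂ) =
      ∫ z : ℝ × ({e : E // e ≠ e₀} → ℝ), cexp (I * q * z.1) * G' z.2 *
        ∏ p, f p ((M p e₀ * z.1 + φ p z.2 : ℝ) : ℂ) ∂((volume : Measure ℝ).prod volume) := by
    rw [← hmp.integral_comp Ψ.symm.measurableEmbedding]
    refine integral_congr_ae (ae_of_all _ fun z => ?_)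
    simp only [hGΨ, hsum, hΨ0]
  have hR : ∫ α : E → ℝ, cexp (I * q * α e₀) * G α *
        ∏ p, f p ((∑ e, M p e * α e : ℝ) + (a * M p e₀ : ℝ) * I) =
      ∫ z : ℝ × ({e : E // e ≠ e₀} → ℝ), cexp (I * q * z.1) * G' z.2 *
        ∏ p, f p ((M p e₀ * z.1 + φ p z.2 : ℝ) + (a * M p e₀ : ℝ) * I) ∂((volume : Measure ℝ).prod volume) := by
    rw [← hmp.integral_comp Ψ.symm.measurableEmbedding]
    refine integral_congr_ae (ae_of_all _ fun z => ?_)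
    simp only [hGΨ, hsum, hΨ0]
  rw [hL, hR]
  exact integral_cexp_mul_prod_eq_exp_mul_integral_translate hw (fun p => M p e₀) hφm
    hG'm.aestronglyMeasurable q ha hint'

/-- **Bound form on `ℝ^E`** (FS82 (2.63)–(2.64) / FS81 (4.15)–(4.16)):
`|∫ e^{iqα_{e₀}} G ∏ₚ fₚ((Mα)ₚ) dα| ≤ e^{-qa + ∑ₚ w(a M_{pe₀})} ∫ |G| ∏ₚ gₚ((Mα)ₚ) dα`; when
`M = d` (entries `0, ±1`) the sum has `n_{xy}` non-zero terms `w(±a) = w(a)`, `n_{xy}` the number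
of plaquettes containing the link `e₀` (`= 2(d-1)`, `= 6` in four dimensions).
[cite: FrohlichSpencerKT1981, Lemma 4.3, (4.15)–(4.16), p. 554]
[cite: FrohlichSpencerCMP1982, Lemma 3, (2.63)–(2.64), p. 428] -/
theorem norm_integral_cexp_mul_prod_le_pi
    (hw : ∀ p, IsStripWeight ε w (g p) (f p)) (e₀ : E) (M : P → E → ℝ)
    {G : (E → ℝ) → ℂ} (hG : Measurable G) (hGe : ∀ α t, G (Function.update α e₀ t) = G α)
    (q : ℝ) {a : ℝ} (ha : ∀ p, |a * M p e₀| < ε)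
    (hint : Integrable (fun α : E → ℝ => ‖G α‖ * ∏ p, g p (∑ e, M p e * α e))) :
    ‖∫ α : E → ℝ, cexp (I * q * α e₀) * G α * ∏ p, f p ((∑ e, M p e * α e : ℝ) : ℂ)‖
      ≤ Real.exp (-(q * a) + ∑ p, w (a * M p e₀)) *
          ∫ α : E → ℝ, ‖G α‖ * ∏ p, g p (∑ e, M p e * α e) := by
  rw [integral_cexp_mul_prod_eq_exp_mul_integral_translate_pi hw e₀ M hG hGe q ha hint, norm_mul,
    Complex.norm_real, Real.norm_eq_abs, Real.abs_exp, Real.exp_add, mul_assoc]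
  refine mul_le_mul_of_nonneg_left ?_ (Real.exp_pos _).le
  rw [← integral_const_mul]
  refine norm_integral_le_of_norm_le (hint.const_mul _) (ae_of_all _ fun α => ?_)
  rw [norm_mul, norm_mul, Complex.norm_exp]
  have hre : (I * q * (α e₀ : ℂ)).re = 0 := by simp [Complex.mul_re, Complex.mul_im]
  rw [hre, Real.exp_zero, one_mul, norm_prod, Real.exp_sum, mul_left_comm, ← Finset.prod_mul_distrib]
  refine mul_le_mul_of_nonneg_left ?_ (norm_nonneg _)
  exact Finset.prod_le_prod (fun p _ => norm_nonneg _) fun p _ =>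
    (hw p).norm_le (∑ e, M p e * α e) (a * M p e₀) (ha p)

end Pi

/-! ### Iterating the translation over a set of links no two of which share a plaquette

FS82 §2.8 applies Lemma 3 "successively" to all links `xy` of a set `𝔅_ρ ⊆ supp ρ` chosen so that
"two different links in `𝔅_ρ` do not belong to a common plaquette" ((2.61)–(2.62)); since then no
plaquette weight is translated twice, the single-coordinate lemma iterates without change of the
hypotheses, the translated factors being absorbed in `G`. The results below
(`integral_cexp_sum_mul_finsetProd_eq_exp_mul_integral_translate`, identity, and
`norm_integral_cexp_sum_mul_finsetProd_le`, bound `e^{-∑ qₑaₑ + ∑ₚ ∑ₑ w(aₑM_{pe})}`) are stated for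
a `Finset` `S` of weight factors and a `Finset` `B` of translated coordinates of `ℝ^E`, with
link-dependent charges `qₑ` and shifts `aₑ` (FS82: `a_{xy} = (β/n_{xy})ρ_{xy}`). -/

section Iterated

variable {E : Type*} [Fintype E] [DecidableEq E]
variable {P : Type*} {ε : ℝ} {w : ℝ → ℝ} {g : P → ℝ → ℝ} {f : P → ℂ → ℂ}

/-- Single-coordinate translation with the weight product over a `Finset` of factors (the other
factors being absorbed in `G`). [cite: FrohlichSpencerKT1981, Lemma 4.3, (4.15), p. 554] -/
theorem integral_cexp_mul_finsetProd_eq_exp_mul_integral_translate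
    (hw : ∀ p, IsStripWeight ε w (g p) (f p)) (S : Finset P) (e₀ : E) (M : P → E → ℝ)
    {G : (E → ℝ) → ℂ} (hG : Measurable G) (hGe : ∀ α t, G (Function.update α e₀ t) = G α)
    (q : ℝ) {a : ℝ} (ha : ∀ p ∈ S, |a * M p e₀| < ε)
    (hint : Integrable (fun α : E → ℝ => ‖G α‖ * ∏ p ∈ S, g p (∑ e, M p e * α e))) :
    ∫ α : E → ℝ, cexp (I * q * α e₀) * G α * ∏ p ∈ S, f p ((∑ e, M p e * α e : ℝ) : ℂ)
      = Real.exp (-(q * a)) * ∫ α : E → ℝ, cexp (I * q * α e₀) * G α *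
          ∏ p ∈ S, f p ((∑ e, M p e * α e : ℝ) + (a * M p e₀ : ℝ) * I) := by
  have e1 : (fun α : E → ℝ => ‖G α‖ * ∏ p : ↥S, g p (∑ e, M p e * α e)) =
      fun α => ‖G α‖ * ∏ p ∈ S, g p (∑ e, M p e * α e) := by
    funext α; rw [Finset.prod_coe_sort S (fun p => g p (∑ e, M p e * α e))]
  have e2 : ∀ α : E → ℝ, ∏ p : ↥S, f p ((∑ e, M p e * α e : ℝ) : ℂ) =
      ∏ p ∈ S, f p ((∑ e, M p e * α e : ℝ) : ℂ) :=
    fun α => Finset.prod_coe_sort S (fun p => f p ((∑ e, M p e * α e : ℝ) : ℂ))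
  have e3 : ∀ α : E → ℝ, ∏ p : ↥S, f p ((∑ e, M p e * α e : ℝ) + (a * M p e₀ : ℝ) * I) =
      ∏ p ∈ S, f p ((∑ e, M p e * α e : ℝ) + (a * M p e₀ : ℝ) * I) :=
    fun α => Finset.prod_coe_sort S (fun p => f p ((∑ e, M p e * α e : ℝ) + (a * M p e₀ : ℝ) * I))
  have h := integral_cexp_mul_prod_eq_exp_mul_integral_translate_pi (P := ↥S)
    (g := fun p => g p) (f := fun p => f p) (fun p => hw p) e₀ (fun p : ↥S => M p) hG hGe q
    (a := a) (fun p => ha p p.2) (by rw [e1]; exact hint)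
  simp_rw [e2, e3] at h
  exact h

/-- Updating a coordinate that a linear form does not see. [folklore] -/
theorem sum_mul_update_of_eq_zero (M : E → ℝ) {e : E} (hM : M e = 0) (α : E → ℝ) (t : ℝ) :
    ∑ e', M e' * Function.update α e t e' = ∑ e', M e' * α e' := by
  refine Finset.sum_congr rfl fun e' _ => ?_
  by_cases h : e' = e
  · subst h; simp [hM]
  · rw [Function.update_of_ne h]

/-- If at most one of the numbers `v e`, `e ∈ B`, is non-zero and `φ(0) = 0`, then
`∑_{e ∈ B} φ(v e) = φ(∑_{e ∈ B} v e)`. [folklore] -/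
theorem sum_apply_eq_apply_sum_of_pairwise {B : Finset E} {v : E → ℝ}
    (h : ∀ e ∈ B, ∀ e' ∈ B, e ≠ e' → v e = 0 ∨ v e' = 0) {β : Type*} [AddCommMonoid β]
    (φ : ℝ → β) (h0 : φ 0 = 0) : ∑ e ∈ B, φ (v e) = φ (∑ e ∈ B, v e) := by
  by_cases hall : ∀ e ∈ B, v e = 0
  · rw [Finset.sum_eq_zero (fun e he => by rw [hall e he, h0]), Finset.sum_eq_zero hall, h0]
  · push Not at hall
    obtain ⟨e₁, he₁, hv⟩ := hall
    have hz : ∀ e ∈ B, e ≠ e₁ → v e = 0 := fun e he hne => (h e he e₁ he₁ hne).resolve_right hv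
    rw [Finset.sum_eq_single_of_mem e₁ he₁ (fun e he hne => by rw [hz e he hne, h0]),
      Finset.sum_eq_single_of_mem e₁ he₁ (fun e he hne => hz e he hne)]

/-- **Iterated complex translation** (the use of Lemma 3 in FS82 Corollary 4 / §2.8: "We then use
Lemma 3 to successively integrate out … for all `xy ∈ 𝔅_ρ`"; FS81 proof of Theorem 4.1): let
`B` be a finite set of coordinates no two of which are seen by a common factor
(`hdisj`: for `p ∈ S` at most one of `M_{pe}`, `e ∈ B`, is non-zero — FS82 (2.61): "two different
links in `𝔅_ρ` do not belong to a common plaquette"), `G` invariant under changing any of them,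
and `|aₑ M_{pe}| < ε`. Then all the coordinates `e ∈ B` can be translated at once,
`αₑ ↦ αₑ + i aₑ`:
`∫ e^{i∑_B qₑαₑ} G ∏_{p∈S} fₚ((Mα)ₚ) dα
  = e^{-∑_B qₑaₑ} ∫ e^{i∑_B qₑαₑ} G ∏_{p∈S} fₚ((Mα)ₚ + i ∑_B aₑ M_{pe}) dα`
(each factor is shifted by at most one `aₑ M_{pe}`). Induction on `B` with the single-coordinate
lemma, the already-translated factors being absorbed in `G`.
[cite: FrohlichSpencerCMP1982, Lemma 3 with (2.61) and Corollary 4, pp. 428–430]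
[cite: FrohlichSpencerKT1981, Lemma 4.3, p. 554] -/
theorem integral_cexp_sum_mul_finsetProd_eq_exp_mul_integral_translate
    (hw : ∀ p, IsStripWeight ε w (g p) (f p)) (M : P → E → ℝ) (q a : E → ℝ) (B : Finset E) :
    ∀ (S : Finset P) (G : (E → ℝ) → ℂ),
      (∀ p ∈ S, ∀ e ∈ B, ∀ e' ∈ B, e ≠ e' → M p e = 0 ∨ M p e' = 0) →
      Measurable G → (∀ e ∈ B, ∀ α t, G (Function.update α e t) = G α) →
      (∀ p ∈ S, ∀ e ∈ B, |a e * M p e| < ε) →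
      Integrable (fun α : E → ℝ => ‖G α‖ * ∏ p ∈ S, g p (∑ e, M p e * α e)) →
      ∫ α : E → ℝ, cexp (I * ((∑ e ∈ B, q e * α e : ℝ) : ℂ)) * G α *
          ∏ p ∈ S, f p ((∑ e, M p e * α e : ℝ) : ℂ)
        = Real.exp (-(∑ e ∈ B, q e * a e)) * ∫ α : E → ℝ, cexp (I * ((∑ e ∈ B, q e * α e : ℝ) : ℂ)) *
            G α * ∏ p ∈ S, f p ((∑ e, M p e * α e : ℝ) + (∑ e ∈ B, a e * M p e : ℝ) * I) := by
  classical
  induction B using Finset.induction_on with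
  | empty =>
    intro S G _ _ _ _ _
    simp
  | insert e₀ B he₀ ih =>
    intro S G hdisj hG hGe ha hint
    -- positivity of `ε` as soon as there is a factor
    have hεS : ∀ p ∈ S, 0 < ε := fun p hp =>
      (abs_nonneg _).trans_lt (ha p hp e₀ (Finset.mem_insert_self _ _))
    -- the linear forms
    set L : P → (E → ℝ) → ℝ := fun p α => ∑ e, M p e * α e with hL_def
    have hLm : ∀ p, Measurable (L p) := fun p =>
      Finset.measurable_sum _ fun e _ => (measurable_pi_apply e).const_mul _
    -- step 1: translate `e₀`, with `G₀ = e^{i∑_B qα} G`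
    set G₀ : (E → ℝ) → ℂ := fun α => cexp (I * ((∑ e ∈ B, q e * α e : ℝ) : ℂ)) * G α with hG₀_def
    have hqm : Measurable fun α : E → ℝ => cexp (I * ((∑ e ∈ B, q e * α e : ℝ) : ℂ)) :=
      Complex.continuous_exp.measurable.comp (measurable_const.mul
        (Complex.measurable_ofReal.comp (Finset.measurable_sum _ fun e _ =>
          (measurable_pi_apply e).const_mul _)))
    have hG₀m : Measurable G₀ := hqm.mul hG
    have hsumB : ∀ (α : E → ℝ) (t : ℝ), ∑ e ∈ B, q e * Function.update α e₀ t e = ∑ e ∈ B, q e * α e := by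
      intro α t
      refine Finset.sum_congr rfl fun e he => ?_
      have hne : e ≠ e₀ := fun h => he₀ (h ▸ he)
      rw [Function.update_of_ne hne]
    have hG₀e : ∀ α t, G₀ (Function.update α e₀ t) = G₀ α := by
      intro α t
      simp only [hG₀_def, hsumB, hGe e₀ (Finset.mem_insert_self _ _)]
    have hnorm₀ : ∀ α, ‖G₀ α‖ = ‖G α‖ := by
      intro α
      rw [hG₀_def, norm_mul, mul_comm I, Complex.norm_exp_ofReal_mul_I, one_mul]
    have hint₀ : Integrable (fun α : E → ℝ => ‖G₀ α‖ * ∏ p ∈ S, g p (∑ e, M p e * α e)) := by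
      simpa only [hnorm₀] using hint
    have step1 := integral_cexp_mul_finsetProd_eq_exp_mul_integral_translate hw S e₀ M hG₀m hG₀e
      (q e₀) (a := a e₀) (fun p hp => ha p hp e₀ (Finset.mem_insert_self _ _)) hint₀
    -- step 2: absorb the translated factors `S₀ = {p ∈ S | M p e₀ ≠ 0}` in `G₁`
    set S₀ := S.filter (fun p => M p e₀ ≠ 0) with hS₀_def
    set S₁ := S.filter (fun p => ¬M p e₀ ≠ 0) with hS₁_def
    have hS₀S : ∀ p ∈ S₀, p ∈ S := fun p hp => (Finset.mem_filter.1 hp).1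
    have hS₁S : ∀ p ∈ S₁, p ∈ S := fun p hp => (Finset.mem_filter.1 hp).1
    have hS₀ne : ∀ p ∈ S₀, M p e₀ ≠ 0 := fun p hp => (Finset.mem_filter.1 hp).2
    have hS₁eq : ∀ p ∈ S₁, M p e₀ = 0 := fun p hp => not_not.1 (Finset.mem_filter.1 hp).2
    -- disjointness consequences
    have hMB : ∀ p ∈ S₀, ∀ e ∈ B, M p e = 0 := by
      intro p hp e he
      have hne : e₀ ≠ e := fun h => he₀ (h ▸ he)
      exact (hdisj p (hS₀S p hp) e₀ (Finset.mem_insert_self _ _) e (Finset.mem_insert_of_mem he)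
        hne).resolve_left (hS₀ne p hp)
    set G₁ : (E → ℝ) → ℂ := fun α => cexp (I * q e₀ * α e₀) * G α *
      ∏ p ∈ S₀, f p ((L p α : ℝ) + (a e₀ * M p e₀ : ℝ) * I) with hG₁_def
    have hG₁m : Measurable G₁ := by
      refine Measurable.mul (Measurable.mul ?_ hG) ?_
      · exact Complex.continuous_exp.measurable.comp
          ((measurable_const.mul (Complex.measurable_ofReal.comp (measurable_pi_apply e₀))))
      · refine Finset.measurable_prod _ fun p hp => ?_
        exact ((hw p).continuous_line (ha p (hS₀S p hp) e₀ (Finset.mem_insert_self _ _))).measurable.comp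
          (hLm p)
    have hG₁e : ∀ e ∈ B, ∀ α t, G₁ (Function.update α e t) = G₁ α := by
      intro e he α t
      have hne : e₀ ≠ e := fun h => he₀ (h ▸ he)
      simp only [hG₁_def, Function.update_of_ne hne, hGe e (Finset.mem_insert_of_mem he)]
      congr 1
      refine Finset.prod_congr rfl fun p hp => ?_
      simp only [hL_def, sum_mul_update_of_eq_zero (M p) (hMB p hp e he)]
    have ha₁ : ∀ p ∈ S₁, ∀ e ∈ B, |a e * M p e| < ε := fun p hp e he =>
      ha p (hS₁S p hp) e (Finset.mem_insert_of_mem he)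
    have hdisj₁ : ∀ p ∈ S₁, ∀ e ∈ B, ∀ e' ∈ B, e ≠ e' → M p e = 0 ∨ M p e' = 0 :=
      fun p hp e he e' he' hne => hdisj p (hS₁S p hp) e (Finset.mem_insert_of_mem he) e'
        (Finset.mem_insert_of_mem he') hne
    -- integrability of `‖G₁‖ ∏_{S₁} g`
    set C : ℝ := ∏ p ∈ S₀, Real.exp (w (a e₀ * M p e₀)) with hC_def
    have hsplit_g : ∀ α, ∏ p ∈ S, g p (L p α) = (∏ p ∈ S₀, g p (L p α)) * ∏ p ∈ S₁, g p (L p α) :=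
      fun α => (Finset.prod_filter_mul_prod_filter_not S (fun p => M p e₀ ≠ 0) _).symm
    have hG₁norm : ∀ α, ‖G₁ α‖ ≤ C * (‖G α‖ * ∏ p ∈ S₀, g p (L p α)) := by
      intro α
      rw [hG₁_def, norm_mul, norm_mul, Complex.norm_exp]
      have hre : (I * (q e₀ : ℂ) * (α e₀ : ℂ)).re = 0 := by simp [Complex.mul_re, Complex.mul_im]
      rw [hre, Real.exp_zero, one_mul, norm_prod, hC_def, mul_left_comm, ← Finset.prod_mul_distrib]
      refine mul_le_mul_of_nonneg_left ?_ (norm_nonneg _)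
      exact Finset.prod_le_prod (fun p _ => norm_nonneg _) fun p hp =>
        (hw p).norm_le (L p α) (a e₀ * M p e₀) (ha p (hS₀S p hp) e₀ (Finset.mem_insert_self _ _))
    have hint₁ : Integrable (fun α : E → ℝ => ‖G₁ α‖ * ∏ p ∈ S₁, g p (∑ e, M p e * α e)) := by
      refine (hint.const_mul C).mono' ?_ (ae_of_all _ fun α => ?_)
      · refine (hG₁m.norm.mul (Finset.measurable_prod _ fun p hp => ?_)).aestronglyMeasurable
        exact ((hw p).continuous (hεS p (hS₁S p hp))).measurable.comp (hLm p)
      · rw [Real.norm_of_nonneg (mul_nonneg (norm_nonneg _)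
          (Finset.prod_nonneg fun p _ => ((hw p).pos _).le))]
        have hprod_nn : 0 ≤ ∏ p ∈ S₁, g p (L p α) := Finset.prod_nonneg fun p _ => ((hw p).pos _).le
        calc ‖G₁ α‖ * ∏ p ∈ S₁, g p (∑ e, M p e * α e)
            ≤ C * (‖G α‖ * ∏ p ∈ S₀, g p (L p α)) * ∏ p ∈ S₁, g p (L p α) :=
              mul_le_mul_of_nonneg_right (hG₁norm α) hprod_nn
          _ = C * (‖G α‖ * ∏ p ∈ S, g p (∑ e, M p e * α e)) := by rw [hsplit_g α]; simp only [hL_def]; ring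
    -- step 3: the induction hypothesis for `S₁`, `G₁`
    have step3 := ih S₁ G₁ hdisj₁ hG₁m hG₁e ha₁ hint₁
    -- pointwise identities between the integrands
    have hcexp : ∀ α : E → ℝ, cexp (I * ((∑ e ∈ insert e₀ B, q e * α e : ℝ) : ℂ)) =
        cexp (I * q e₀ * α e₀) * cexp (I * ((∑ e ∈ B, q e * α e : ℝ) : ℂ)) := by
      intro α
      rw [Finset.sum_insert he₀, ← Complex.exp_add]
      congr 1
      push_cast
      ring
    have hshift₀ : ∀ p ∈ S₀, ∑ e ∈ insert e₀ B, a e * M p e = a e₀ * M p e₀ := by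
      intro p hp
      rw [Finset.sum_insert he₀, Finset.sum_eq_zero (fun e he => by rw [hMB p hp e he, mul_zero]),
        add_zero]
    have hshift₁ : ∀ p ∈ S₁, ∑ e ∈ insert e₀ B, a e * M p e = ∑ e ∈ B, a e * M p e := by
      intro p hp
      rw [Finset.sum_insert he₀, hS₁eq p hp, mul_zero, zero_add]
    have hprod₁ : ∀ α : E → ℝ, ∏ p ∈ S, f p ((L p α : ℝ) + (a e₀ * M p e₀ : ℝ) * I) =
        (∏ p ∈ S₀, f p ((L p α : ℝ) + (a e₀ * M p e₀ : ℝ) * I)) * ∏ p ∈ S₁, f p ((L p α : ℝ) : ℂ) := by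
      intro α
      rw [← Finset.prod_filter_mul_prod_filter_not S (fun p => M p e₀ ≠ 0)]
      congr 1
      refine Finset.prod_congr rfl fun p hp => ?_
      rw [hS₁eq p hp, mul_zero, Complex.ofReal_zero, zero_mul, add_zero]
    have hprod₂ : ∀ α : E → ℝ, ∏ p ∈ S, f p ((L p α : ℝ) + (∑ e ∈ insert e₀ B, a e * M p e : ℝ) * I) =
        (∏ p ∈ S₀, f p ((L p α : ℝ) + (a e₀ * M p e₀ : ℝ) * I)) *
          ∏ p ∈ S₁, f p ((L p α : ℝ) + (∑ e ∈ B, a e * M p e : ℝ) * I) := by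
      intro α
      rw [← Finset.prod_filter_mul_prod_filter_not S (fun p => M p e₀ ≠ 0)]
      congr 1
      · exact Finset.prod_congr rfl fun p hp => by rw [hshift₀ p hp]
      · exact Finset.prod_congr rfl fun p hp => by rw [hshift₁ p hp]
    -- assembling
    calc ∫ α : E → ℝ, cexp (I * ((∑ e ∈ insert e₀ B, q e * α e : ℝ) : ℂ)) * G α *
          ∏ p ∈ S, f p ((∑ e, M p e * α e : ℝ) : ℂ)
        = ∫ α : E → ℝ, cexp (I * q e₀ * α e₀) * G₀ α * ∏ p ∈ S, f p ((∑ e, M p e * α e : ℝ) : ℂ) := by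
          refine integral_congr_ae (ae_of_all _ fun α => ?_)
          dsimp only
          rw [hcexp α, hG₀_def]
          ring
      _ = Real.exp (-(q e₀ * a e₀)) * ∫ α : E → ℝ, cexp (I * q e₀ * α e₀) * G₀ α *
          ∏ p ∈ S, f p ((∑ e, M p e * α e : ℝ) + (a e₀ * M p e₀ : ℝ) * I) := step1
      _ = Real.exp (-(q e₀ * a e₀)) * ∫ α : E → ℝ, cexp (I * ((∑ e ∈ B, q e * α e : ℝ) : ℂ)) * G₁ α *
          ∏ p ∈ S₁, f p ((∑ e, M p e * α e : ℝ) : ℂ) := by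
          congr 1
          refine integral_congr_ae (ae_of_all _ fun α => ?_)
          dsimp only
          have h1 := hprod₁ α
          simp only [hL_def] at h1
          rw [h1, hG₀_def, hG₁_def]
          ring
      _ = Real.exp (-(q e₀ * a e₀)) * (Real.exp (-(∑ e ∈ B, q e * a e)) *
          ∫ α : E → ℝ, cexp (I * ((∑ e ∈ B, q e * α e : ℝ) : ℂ)) * G₁ α *
            ∏ p ∈ S₁, f p ((∑ e, M p e * α e : ℝ) + (∑ e ∈ B, a e * M p e : ℝ) * I)) := by
          rw [step3]
      _ = Real.exp (-(∑ e ∈ insert e₀ B, q e * a e)) * ∫ α : E → ℝ,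
          cexp (I * ((∑ e ∈ insert e₀ B, q e * α e : ℝ) : ℂ)) * G α *
            ∏ p ∈ S, f p ((∑ e, M p e * α e : ℝ) + (∑ e ∈ insert e₀ B, a e * M p e : ℝ) * I) := by
          rw [← mul_assoc, ← Complex.ofReal_mul, ← Real.exp_add, Finset.sum_insert he₀, neg_add]
          congr 1
          refine integral_congr_ae (ae_of_all _ fun α => ?_)
          dsimp only
          have h2 := hprod₂ α
          simp only [hL_def] at h2
          rw [h2, hcexp α, hG₁_def]
          ring


/-- **Iterated complex translation, bound form** (FS82 (2.69)–(2.70): the renormalised activity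
`z(β, ρ) = K(ρ) exp[-(β/2) ∑_{xy ∈ 𝔅_ρ} n_{xy}⁻¹ ρ²_{xy}]`): under the hypotheses of
`integral_cexp_sum_mul_finsetProd_eq_exp_mul_integral_translate`,
`|∫ e^{i∑_B qₑαₑ} G ∏_{p∈S} fₚ((Mα)ₚ) dα| ≤ e^{-∑_B qₑaₑ + ∑_{p∈S} ∑_{e∈B} w(aₑM_{pe})} ∫ |G| ∏_{p∈S} gₚ((Mα)ₚ) dα`
(for each factor at most one penalty `w(aₑ M_{pe})` is non-zero).
[cite: FrohlichSpencerCMP1982, Lemma 3, (2.64), (2.69)–(2.70), pp. 428–429]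
[cite: FrohlichSpencerKT1981, Lemma 4.3, (4.15)–(4.16), p. 554] -/
theorem norm_integral_cexp_sum_mul_finsetProd_le
    (hw : ∀ p, IsStripWeight ε w (g p) (f p)) (M : P → E → ℝ) (q a : E → ℝ) (B : Finset E)
    (S : Finset P) {G : (E → ℝ) → ℂ}
    (hdisj : ∀ p ∈ S, ∀ e ∈ B, ∀ e' ∈ B, e ≠ e' → M p e = 0 ∨ M p e' = 0)
    (hG : Measurable G) (hGe : ∀ e ∈ B, ∀ α t, G (Function.update α e t) = G α)
    (ha : ∀ p ∈ S, ∀ e ∈ B, |a e * M p e| < ε)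
    (hint : Integrable (fun α : E → ℝ => ‖G α‖ * ∏ p ∈ S, g p (∑ e, M p e * α e))) :
    ‖∫ α : E → ℝ, cexp (I * ((∑ e ∈ B, q e * α e : ℝ) : ℂ)) * G α *
        ∏ p ∈ S, f p ((∑ e, M p e * α e : ℝ) : ℂ)‖
      ≤ Real.exp (-(∑ e ∈ B, q e * a e) + ∑ p ∈ S, ∑ e ∈ B, w (a e * M p e)) *
          ∫ α : E → ℝ, ‖G α‖ * ∏ p ∈ S, g p (∑ e, M p e * α e) := by
  -- the shift of the factor `p` and its penalty
  have hpair : ∀ p ∈ S, ∀ e ∈ B, ∀ e' ∈ B, e ≠ e' → a e * M p e = 0 ∨ a e' * M p e' = 0 := by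
    intro p hp e he e' he' hne
    rcases hdisj p hp e he e' he' hne with h | h
    · exact Or.inl (by rw [h, mul_zero])
    · exact Or.inr (by rw [h, mul_zero])
  have hfac : ∀ p ∈ S, ∀ x : ℝ, ‖f p (x + ((∑ e ∈ B, a e * M p e : ℝ) : ℂ) * I)‖ ≤
      Real.exp (∑ e ∈ B, w (a e * M p e)) * g p x := by
    intro p hp x
    rw [sum_apply_eq_apply_sum_of_pairwise (hpair p hp) w (hw p).zero]
    by_cases hs : ∑ e ∈ B, a e * M p e = 0
    · rw [hs, (hw p).zero, Real.exp_zero, one_mul, Complex.ofReal_zero, zero_mul, add_zero,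
        (hw p).norm_ofReal]
    · obtain ⟨e₁, he₁, hv⟩ := Finset.exists_ne_zero_of_sum_ne_zero hs
      have hz : ∀ e ∈ B, e ≠ e₁ → a e * M p e = 0 := fun e he hne =>
        (hpair p hp e he e₁ he₁ hne).resolve_right hv
      rw [Finset.sum_eq_single_of_mem e₁ he₁ (fun e he hne => hz e he hne)]
      exact (hw p).norm_le x (a e₁ * M p e₁) (ha p hp e₁ he₁)
  rw [integral_cexp_sum_mul_finsetProd_eq_exp_mul_integral_translate hw M q a B S G hdisj hG hGe ha
    hint, norm_mul, Complex.norm_real, Real.norm_eq_abs, Real.abs_exp, Real.exp_add, mul_assoc]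
  refine mul_le_mul_of_nonneg_left ?_ (Real.exp_pos _).le
  rw [← integral_const_mul]
  refine norm_integral_le_of_norm_le (hint.const_mul _) (ae_of_all _ fun α => ?_)
  rw [norm_mul, norm_mul, mul_comm I, Complex.norm_exp_ofReal_mul_I, one_mul, norm_prod,
    Real.exp_sum, mul_left_comm, ← Finset.prod_mul_distrib]
  refine mul_le_mul_of_nonneg_left ?_ (norm_nonneg _)
  exact Finset.prod_le_prod (fun p _ => norm_nonneg _) fun p hp => hfac p hp _

end Iterated

/-! ### Finiteness of the gauge-fixed configuration integral for exponentially decaying weights -/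

section Finiteness

variable {ι : Type*} [Fintype ι]

/-- `(1 + t)ⁿ e^{-δt} ≤ n! δ⁻ⁿ e^{δ}` for `t ≥ 0`, `δ > 0`. [folklore] -/
theorem one_add_pow_mul_exp_neg_mul_le {δ : ℝ} (hδ : 0 < δ) (n : ℕ) {t : ℝ} (ht : 0 ≤ t) :
    (1 + t) ^ n * Real.exp (-(δ * t)) ≤ n.factorial * δ⁻¹ ^ n * Real.exp δ := by
  have h := Real.pow_div_factorial_le_exp (x := δ * (1 + t)) (by positivity) n
  rw [div_le_iff₀ (by positivity), mul_pow] at h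
  have hδn : 0 < δ ^ n := pow_pos hδ n
  rw [inv_pow, show Real.exp δ = Real.exp (δ * (1 + t)) * Real.exp (-(δ * t)) by
    rw [← Real.exp_add]; ring_nf]
  rw [show (n.factorial : ℝ) * (δ ^ n)⁻¹ * (Real.exp (δ * (1 + t)) * Real.exp (-(δ * t))) =
      (Real.exp (δ * (1 + t)) * n.factorial) * (δ ^ n)⁻¹ * Real.exp (-(δ * t)) by ring]
  refine mul_le_mul_of_nonneg_right ?_ (Real.exp_pos _).le
  rw [le_mul_inv_iff₀ hδn]
  linarith

/-- `e^{-δ‖x‖}` is integrable on `ℝ^ι` (`δ > 0`), by comparison with `(1 + ‖x‖)^{-(|ι|+1)}`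
(`integrable_one_add_norm`). [folklore] -/
theorem integrable_exp_neg_mul_norm_pi {δ : ℝ} (hδ : 0 < δ) :
    Integrable fun x : ι → ℝ => Real.exp (-(δ * ‖x‖)) := by
  haveI : (volume : Measure (ι → ℝ)).IsAddHaarMeasure := isAddHaarMeasure_volume_pi _
  have hdim : (Module.finrank ℝ (ι → ℝ) : ℝ) < (Fintype.card ι + 1 : ℕ) := by simp
  have hint : Integrable (fun x : ι → ℝ => (1 + ‖x‖) ^ (-((Fintype.card ι + 1 : ℕ) : ℝ))) :=
    integrable_one_add_norm hdim
  set n := Fintype.card ι + 1 with hn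
  set K : ℝ := n.factorial * δ⁻¹ ^ n * Real.exp δ with hK
  refine (hint.const_mul K).mono' (by fun_prop) (ae_of_all _ fun x => ?_)
  rw [Real.norm_eq_abs, Real.abs_exp]
  have hpos : 0 < (1 + ‖x‖) ^ n := by positivity
  rw [Real.rpow_neg (by positivity), Real.rpow_natCast, le_mul_inv_iff₀ hpos, mul_comm]
  exact one_add_pow_mul_exp_neg_mul_le hδ n (norm_nonneg x)

variable {P : Type*} [Fintype P]

/-- **Finiteness of the configuration integral after gauge fixing** (FS81 Condition (4.10)(i) in
the form needed for the dual gauge models): if the linear map `α ↦ Mα` is INJECTIVE on `ℝ^ι` (e.g.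
the coboundary `d` restricted to the links left free by an axial gauge) and the weights satisfy
`0 ≤ gₚ(φ) ≤ C e^{-κ|φ|}` (`κ > 0`; the Gaussian and the Bessel interpolation both do), then
`α ↦ ∏ₚ gₚ((Mα)ₚ)` is integrable on `ℝ^ι`: by the open mapping theorem in finite dimension
`‖α‖ ≤ K ∑ₚ |(Mα)ₚ|`, so the product is `≤ C^{|P|} e^{-(κ/K)‖α‖}`. [folklore] -/
theorem integrable_prod_of_injective_of_le_exp (M : P → ι → ℝ)
    (hM : Function.Injective fun α : ι → ℝ => fun p => ∑ e, M p e * α e)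
    (g : P → ℝ → ℝ) (hgm : ∀ p, Measurable (g p)) {C κ : ℝ} (hκ : 0 < κ)
    (hg0 : ∀ p x, 0 ≤ g p x) (hgC : ∀ p x, g p x ≤ C * Real.exp (-(κ * |x|))) :
    Integrable fun α : ι → ℝ => ∏ p, g p (∑ e, M p e * α e) := by
  -- the linear map and its inverse on the range
  set L : (ι → ℝ) →ₗ[ℝ] (P → ℝ) :=
    { toFun := fun α p => ∑ e, M p e * α e
      map_add' := fun α β => by funext p; simp only [Pi.add_apply, mul_add, Finset.sum_add_distrib]
      map_smul' := fun c α => by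
        funext p; simp only [Pi.smul_apply, smul_eq_mul, RingHom.id_apply, Finset.mul_sum]
        exact Finset.sum_congr rfl fun e _ => by ring } with hL_def
  have hLinj : Function.Injective L := hM
  set eL := (LinearEquiv.ofInjective L hLinj).toContinuousLinearEquiv with heL
  set K : ℝ := ‖(eL.symm : ↥(LinearMap.range L) →L[ℝ] (ι → ℝ))‖ + 1 with hK_def
  have hK : 0 < K := by positivity
  have hanti : ∀ α : ι → ℝ, ‖α‖ ≤ K * ∑ p, |∑ e, M p e * α e| := by
    intro α
    have h1 : α = eL.symm (eL α) := (eL.symm_apply_apply α).symm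
    have h2 : ‖α‖ ≤ ‖(eL.symm : ↥(LinearMap.range L) →L[ℝ] (ι → ℝ))‖ * ‖eL α‖ := by
      conv_lhs => rw [h1]
      exact (eL.symm : ↥(LinearMap.range L) →L[ℝ] (ι → ℝ)).le_opNorm _
    have h3 : ‖eL α‖ = ‖L α‖ := rfl
    have h4 : ‖L α‖ ≤ ∑ p, |∑ e, M p e * α e| := by
      refine (pi_norm_le_iff_of_nonneg (Finset.sum_nonneg fun p _ => abs_nonneg _)).2 fun p => ?_
      rw [Real.norm_eq_abs]
      exact Finset.single_le_sum (f := fun p => |∑ e, M p e * α e|) (fun p _ => abs_nonneg _)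
        (Finset.mem_univ p)
    calc ‖α‖ ≤ ‖(eL.symm : ↥(LinearMap.range L) →L[ℝ] (ι → ℝ))‖ * ‖eL α‖ := h2
      _ ≤ K * ‖eL α‖ := by
          refine mul_le_mul_of_nonneg_right (by linarith) (norm_nonneg _)
      _ ≤ K * ∑ p, |∑ e, M p e * α e| := by rw [h3]; exact mul_le_mul_of_nonneg_left h4 hK.le
  -- `C ≥ 0` unless there is no factor
  by_cases hP : IsEmpty P
  · -- no factors: the product is `1`, and `ℝ^ι` is a point (injectivity)
    have hι : ∀ α : ι → ℝ, α = 0 := fun α => by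
      have := hanti α
      simp only [Finset.univ_eq_empty, Finset.sum_empty, mul_zero, norm_le_zero_iff] at this
      exact this
    have : (fun α : ι → ℝ => ∏ p, g p (∑ e, M p e * α e)) = fun _ => 1 := by
      funext α; simp [Finset.univ_eq_empty]
    rw [this]
    haveI : Subsingleton (ι → ℝ) := ⟨fun a b => by rw [hι a, hι b]⟩
    haveI : IsFiniteMeasure (volume : Measure (ι → ℝ)) := by
      refine ⟨?_⟩
      have hu : (Set.univ : Set (ι → ℝ)) = Set.pi Set.univ (fun _ : ι => Set.Icc (0 : ℝ) 0) := by
        ext α; simp only [Set.mem_univ, Set.mem_pi, Set.mem_Icc, true_iff, forall_const]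
        intro i; rw [hι α]; simp
      rw [hu, volume_pi_pi]
      simp
    exact integrable_const _
  rw [not_isEmpty_iff] at hP
  obtain ⟨p₀⟩ := hP
  have hC : 0 ≤ C := by
    have := (hg0 p₀ 0).trans (hgC p₀ 0)
    simpa using this
  -- domination by `C^{|P|} e^{-(κ/K)‖α‖}`
  have hdom : ∀ α : ι → ℝ, ∏ p, g p (∑ e, M p e * α e) ≤
      C ^ Fintype.card P * Real.exp (-(κ / K * ‖α‖)) := by
    intro α
    calc ∏ p, g p (∑ e, M p e * α e) ≤ ∏ p, C * Real.exp (-(κ * |∑ e, M p e * α e|)) :=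
          Finset.prod_le_prod (fun p _ => hg0 p _) fun p _ => hgC p _
      _ = C ^ Fintype.card P * Real.exp (-(κ * ∑ p, |∑ e, M p e * α e|)) := by
          rw [Finset.prod_mul_distrib, Finset.prod_const, Finset.card_univ, ← Real.exp_sum,
            Finset.mul_sum, ← Finset.sum_neg_distrib]
      _ ≤ C ^ Fintype.card P * Real.exp (-(κ / K * ‖α‖)) := by
          refine mul_le_mul_of_nonneg_left (Real.exp_le_exp.2 ?_) (pow_nonneg hC _)
          have := hanti α
          rw [neg_le_neg_iff, div_mul_eq_mul_div, div_le_iff₀ hK]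
          nlinarith
  refine ((integrable_exp_neg_mul_norm_pi (ι := ι) (div_pos hκ hK)).const_mul
    (C ^ Fintype.card P)).mono' ?_ (ae_of_all _ fun α => ?_)
  · refine (Finset.measurable_prod _ fun p _ => (hgm p).comp ?_).aestronglyMeasurable
    exact Finset.measurable_sum _ fun e _ => (measurable_pi_apply e).const_mul _
  · rw [Real.norm_of_nonneg (Finset.prod_nonneg fun p _ => hg0 p _)]
    exact hdom α

/-- The Gaussian weight decays exponentially: `e^{-φ²/2β} ≤ e^{β/2} e^{-|φ|}` (`β > 0`). [folklore] -/
theorem exp_neg_sq_div_le_exp_neg_abs {β : ℝ} (hβ : 0 < β) (φ : ℝ) :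
    Real.exp (-(φ ^ 2 / (2 * β))) ≤ Real.exp (β / 2) * Real.exp (-(1 * |φ|)) := by
  rw [← Real.exp_add, one_mul]
  refine Real.exp_le_exp.2 ?_
  have h1 : |φ| ^ 2 = φ ^ 2 := sq_abs φ
  have h2 : 0 ≤ (|φ| - β) ^ 2 := sq_nonneg _
  have h3 : 2 * β * |φ| ≤ φ ^ 2 + β ^ 2 := by nlinarith
  rw [neg_le, neg_add, neg_neg]
  rw [show -(β / 2) + |φ| = (2 * β * |φ| - β ^ 2) / (2 * β) by field_simp; ring]
  exact div_le_div_of_nonneg_right (by linarith) (by positivity)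

end Finiteness

/-! ### General holomorphic integrands: translation across a poly-strip

The same Fubini-plus-one-variable argument, with no product structure: for `F` holomorphic on the
closed poly-strip `{z ∈ ℂ^E | Im zₑ ∈ [[0, τₑ]] ∀ e}` and dominated there by an integrable function
of `Re z`, `∫ F(x) dx = ∫ F(x + iτ) dx`. This is the form in which complex translations by a
general imaginary VECTOR are made in FS81 (Lemma 4.4, (4.36): `φ(j) → φ(j) + ia(j)` on a whole
disc; Sect. 6, property (6.4) of `dμ_{I_β}`), where the translated coordinates do share factors. -/

section Polystrip

variable {E : Type*} [Fintype E] [DecidableEq E]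

/-- The point of `ℂ^E` with real part `x` and imaginary part `σ`. [folklore] -/
def reIm (x σ : E → ℝ) : E → ℂ := fun e => (x e : ℂ) + (σ e : ℂ) * I

omit [Fintype E] [DecidableEq E] in
/-- `reIm x 0 = x`. [folklore] -/
@[simp] theorem reIm_zero (x : E → ℝ) : reIm x 0 = fun e => (x e : ℂ) := by
  funext e; simp [reIm]

/-- **Translation across a poly-strip.** Let `F : ℂ^E → ℂ` be complex differentiable on the closed
poly-strip `U = {z | Im zₑ ∈ [[0, τₑ]] for all e}` and dominated on it by an integrable function of
the real part: `‖F(x + iσ)‖ ≤ Φ(x)` whenever `σₑ ∈ [[0, τₑ]]` for all `e`. Then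
`∫_{ℝ^E} F(x) dx = ∫_{ℝ^E} F(x + iτ) dx`. (Induction over the coordinates: each step is the
one-variable contour shift `integral_eq_integral_add_mul_I_of_integrable_strip` on a.e. fibre of
`splitAt`, glued by Fubini; no decay of `F` at infinity is needed beyond the integrable majorant.)
[folklore] -/
theorem integral_eq_integral_reIm_of_differentiableOn (F : (E → ℂ) → ℂ) (τ : E → ℝ)
    (hF : DifferentiableOn ℂ F {z : E → ℂ | ∀ e, (z e).im ∈ uIcc 0 (τ e)})
    {Φ : (E → ℝ) → ℝ} (hΦ : Integrable Φ)
    (hdom : ∀ x σ : E → ℝ, (∀ e, σ e ∈ uIcc 0 (τ e)) → ‖F (reIm x σ)‖ ≤ Φ x) :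
    ∫ x : E → ℝ, F (fun e => (x e : ℂ)) = ∫ x : E → ℝ, F (reIm x τ) := by
  set U : Set (E → ℂ) := {z : E → ℂ | ∀ e, (z e).im ∈ uIcc 0 (τ e)} with hU_def
  have hFc : ContinuousOn F U := hF.continuousOn
  -- partial translations `τ_B = τ 𝟙_B`
  let τB : Finset E → E → ℝ := fun B e => if e ∈ B then τ e else 0
  have hτB_mem : ∀ (B : Finset E) (e : E), τB B e ∈ uIcc 0 (τ e) := by
    intro B e
    by_cases h : e ∈ B <;> simp [τB, h, Set.left_mem_uIcc, Set.right_mem_uIcc]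
  suffices key : ∀ B : Finset E, ∫ x : E → ℝ, F (reIm x (τB B)) = ∫ x : E → ℝ, F (fun e => (x e : ℂ)) by
    have h := key Finset.univ
    have hτ : τB Finset.univ = τ := by funext e; simp [τB]
    rw [hτ] at h
    exact h.symm
  intro B
  induction B using Finset.induction_on with
  | empty =>
    have h0 : τB ∅ = 0 := by funext e; simp [τB]
    simp only [h0, reIm_zero]
  | insert e₀ B he₀ ih =>
    rw [← ih]
    -- reduce to the translation of the coordinate `e₀` by `τ e₀`
    set Ψ := splitAt e₀ with hΨ
    have hmp : MeasurePreserving Ψ.symm ((volume : Measure ℝ).prod volume) volume :=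
      volume_preserving_splitAt_symm e₀
    -- the complex points `ζ(z, y)`: `z` at `e₀`, `y + iτ_B` elsewhere
    let ζ : ℂ → ({e : E // e ≠ e₀} → ℝ) → (E → ℂ) := fun z y e =>
      if h : e = e₀ then z else (y ⟨e, h⟩ : ℂ) + (τB B e : ℂ) * I
    have hζe₀ : ∀ z y, ζ z y e₀ = z := fun z y => by simp [ζ]
    have hζne : ∀ z y (e : E) (h : e ≠ e₀), ζ z y e = (y ⟨e, h⟩ : ℂ) + (τB B e : ℂ) * I :=
      fun z y e h => by simp [ζ, h]
    have hτB0 : τB B e₀ = 0 := by simp [τB, he₀]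
    have hτB' : ∀ e, τB (insert e₀ B) e = if e = e₀ then τ e₀ else τB B e := by
      intro e; by_cases h : e = e₀ <;> simp [τB, h, he₀]
    -- `ζ` realises the two integrands along `Ψ.symm`
    have hζ_re : ∀ (t : ℝ) (y : {e : E // e ≠ e₀} → ℝ) (s : ℝ),
        ζ ((t : ℂ) + (s : ℂ) * I) y = reIm (Ψ.symm (t, y)) (fun e => if e = e₀ then s else τB B e) := by
      intro t y s
      funext e
      by_cases h : e = e₀
      · subst h
        rw [hζe₀]
        simp [reIm, hΨ]
      · rw [hζne _ _ e h]
        have := splitAt_symm_apply_coe e₀ (t, y) ⟨e, h⟩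
        simp only at this
        simp [reIm, h, hΨ, this]
    have hB_eq : ∀ (t : ℝ) (y : {e : E // e ≠ e₀} → ℝ), reIm (Ψ.symm (t, y)) (τB B) = ζ (t : ℂ) y := by
      intro t y
      have h := hζ_re t y 0
      simp only [Complex.ofReal_zero, zero_mul, add_zero] at h
      rw [h]
      congr 1
      funext e
      by_cases he : e = e₀
      · subst he; simp [hτB0]
      · simp [he]
    have hB'_eq : ∀ (t : ℝ) (y : {e : E // e ≠ e₀} → ℝ),
        reIm (Ψ.symm (t, y)) (τB (insert e₀ B)) = ζ ((t : ℂ) + (τ e₀ : ℂ) * I) y := by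
      intro t y
      rw [hζ_re t y (τ e₀)]
      congr 1
      funext e
      rw [hτB' e]
    -- `ζ(·, y)` is an affine holomorphic curve into the poly-strip, continuous in `(z, y)`
    have hζ_diff : ∀ y, Differentiable ℂ (fun z => ζ z y) := by
      intro y
      refine differentiable_pi.2 fun e => ?_
      by_cases h : e = e₀
      · subst h; simp only [hζe₀]; exact differentiable_id
      · simp only [hζne _ _ e h]; exact differentiable_const _
    have hζ_mem : ∀ (z : ℂ) (y : {e : E // e ≠ e₀} → ℝ), z.im ∈ uIcc 0 (τ e₀) → ζ z y ∈ U := by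
      intro z y hz e
      by_cases h : e = e₀
      · subst h; simpa [hζe₀] using hz
      · rw [hζne _ _ e h]
        simpa using hτB_mem B e
    have hζ_cont : Continuous fun p : ℂ × ({e : E // e ≠ e₀} → ℝ) => ζ p.1 p.2 := by
      refine continuous_pi fun e => ?_
      by_cases h : e = e₀
      · subst h; simp only [hζe₀]; exact continuous_fst
      · simp only [hζne _ _ e h]
        exact ((Complex.continuous_ofReal.comp ((continuous_apply _).comp continuous_snd)).add
          continuous_const)
    -- holomorphy of the fibre maps on the closed strip
    have hdiff : ∀ y, DifferentiableOn ℂ (fun z => F (ζ z y)) (univ ×ℂ uIcc 0 (τ e₀)) := by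
      intro y z hz
      have hzU : ζ z y ∈ U := hζ_mem z y (Complex.mem_reProdIm.1 hz).2
      exact (hF (ζ z y) hzU).comp z (hζ_diff y z).differentiableWithinAt
        (fun z' hz' => hζ_mem z' y (Complex.mem_reProdIm.1 hz').2)
    -- the majorant along the fibres
    have hdomζ : ∀ (t s : ℝ) (y : {e : E // e ≠ e₀} → ℝ), s ∈ uIcc 0 (τ e₀) →
        ‖F (ζ ((t : ℂ) + (s : ℂ) * I) y)‖ ≤ Φ (Ψ.symm (t, y)) := by
      intro t s y hs
      rw [hζ_re]
      refine hdom _ _ fun e => ?_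
      by_cases h : e = e₀
      · subst h; simpa using hs
      · simpa [h] using hτB_mem B e
    have hΦ' : Integrable (fun z : ℝ × ({e : E // e ≠ e₀} → ℝ) => Φ (Ψ.symm z))
        ((volume : Measure ℝ).prod volume) :=
      (hmp.integrable_comp_emb Ψ.symm.measurableEmbedding).2 hΦ
    -- measurability and integrability on the lines `Im = s`
    have hmeas : ∀ s : ℝ, s ∈ uIcc 0 (τ e₀) →
        AEStronglyMeasurable (fun z : ℝ × ({e : E // e ≠ e₀} → ℝ) => F (ζ ((z.1 : ℂ) + (s : ℂ) * I) z.2))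
          ((volume : Measure ℝ).prod volume) := by
      intro s hs
      have hc2 : Continuous fun z : ℝ × ({e : E // e ≠ e₀} → ℝ) => (((z.1 : ℂ) + (s : ℂ) * I), z.2) :=
        (((Complex.continuous_ofReal.comp continuous_fst).add continuous_const).prodMk continuous_snd)
      refine (hFc.comp_continuous (hζ_cont.comp hc2) fun z => ?_).aestronglyMeasurable
      exact hζ_mem _ _ (by simpa using hs)
    have hInt : ∀ s : ℝ, s ∈ uIcc 0 (τ e₀) →
        Integrable (fun z : ℝ × ({e : E // e ≠ e₀} → ℝ) => F (ζ ((z.1 : ℂ) + (s : ℂ) * I) z.2))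
          ((volume : Measure ℝ).prod volume) :=
      fun s hs => hΦ'.mono' (hmeas s hs) (ae_of_all _ fun z => hdomζ z.1 s z.2 hs)
    -- the one-variable shift on a.e. fibre
    have hμ : ((volume : Measure ℝ).prod (volume.restrict (uIcc (0 : ℝ) (τ e₀)))) =
        ((volume : Measure ℝ).prod (volume : Measure ℝ)).restrict (Set.univ ×ˢ uIcc (0 : ℝ) (τ e₀)) := by
      rw [← Measure.prod_restrict, Measure.restrict_univ]
    have hae : ∀ᵐ y : {e : E // e ≠ e₀} → ℝ,
        ∫ t : ℝ, F (ζ t y) = ∫ t : ℝ, F (ζ ((t : ℂ) + (τ e₀ : ℂ) * I) y) := by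
      filter_upwards [hΦ'.prod_left_ae] with y hy
      have hcont : ContinuousOn (fun z => F (ζ z y)) (univ ×ℂ uIcc 0 (τ e₀)) := (hdiff y).continuousOn
      apply integral_eq_integral_add_mul_I_of_integrable_strip (fun z => F (ζ z y)) (τ e₀) (hdiff y)
      · refine hy.mono' ?_ (ae_of_all _ fun t => ?_)
        · refine (hcont.comp_continuous continuous_ofReal fun t => ?_).aestronglyMeasurable
          simp [Complex.mem_reProdIm]
        · simpa using hdomζ t 0 y left_mem_uIcc
      · refine hy.mono' ?_ (ae_of_all _ fun t => hdomζ t (τ e₀) y right_mem_uIcc)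
        refine (hcont.comp_continuous (by fun_prop) fun t => ?_).aestronglyMeasurable
        simp [Complex.mem_reProdIm]
      · rw [hμ]
        refine Integrable.mono' (g := fun z : ℝ × ℝ => Φ (Ψ.symm (z.1, y))) ?_ ?_ ?_
        · rw [← hμ]
          have h1 : Integrable (fun _ : ℝ => (1 : ℝ)) (volume.restrict (uIcc (0 : ℝ) (τ e₀))) :=
            (continuous_const.integrableOn_uIcc :
              IntegrableOn (fun _ : ℝ => (1 : ℝ)) (uIcc 0 (τ e₀)) volume)
          simpa using hy.mul_prod h1
        · refine ContinuousOn.aestronglyMeasurable ?_ (MeasurableSet.univ.prod measurableSet_uIcc)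
          refine hcont.comp (by fun_prop) fun z hz => ?_
          simpa [Complex.mem_reProdIm] using hz
        · filter_upwards [ae_restrict_mem (MeasurableSet.univ.prod measurableSet_uIcc)] with z hz
          exact hdomζ z.1 z.2 y hz.2
    -- Fubini
    calc ∫ x : E → ℝ, F (reIm x (τB (insert e₀ B)))
        = ∫ z : ℝ × ({e : E // e ≠ e₀} → ℝ), F (ζ ((z.1 : ℂ) + (τ e₀ : ℂ) * I) z.2)
            ∂((volume : Measure ℝ).prod volume) := by
          rw [← hmp.integral_comp Ψ.symm.measurableEmbedding]
          refine integral_congr_ae (ae_of_all _ fun z => ?_)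
          exact congrArg F (hB'_eq z.1 z.2)
      _ = ∫ y : {e : E // e ≠ e₀} → ℝ, (∫ t : ℝ, F (ζ ((t : ℂ) + (τ e₀ : ℂ) * I) y)) :=
          integral_prod_symm _ (hInt _ right_mem_uIcc)
      _ = ∫ y : {e : E // e ≠ e₀} → ℝ, (∫ t : ℝ, F (ζ (t : ℂ) y)) := (integral_congr_ae hae).symm
      _ = ∫ z : ℝ × ({e : E // e ≠ e₀} → ℝ), F (ζ (z.1 : ℂ) z.2) ∂((volume : Measure ℝ).prod volume) := by
          have h0 := hInt 0 left_mem_uIcc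
          simp only [Complex.ofReal_zero, zero_mul, add_zero] at h0
          exact (integral_prod_symm _ h0).symm
      _ = ∫ x : E → ℝ, F (reIm x (τB B)) := by
          rw [← hmp.integral_comp Ψ.symm.measurableEmbedding]
          refine integral_congr_ae (ae_of_all _ fun z => ?_)
          exact congrArg F (hB_eq z.1 z.2).symm

variable {P : Type*} [Fintype P] {ε : ℝ} {w : ℝ → ℝ} {g : P → ℝ → ℝ} {f : P → ℂ → ℂ}

omit [DecidableEq E] in
/-- The imaginary parts of the linear forms along the box `σ ∈ ∏ₑ [[0, τₑ]]` are bounded by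
`∑ₑ |M_{pe} τₑ|`. [folklore] -/
theorem abs_sum_mul_le_of_mem_uIcc (M : E → ℝ) {τ σ : E → ℝ} (hσ : ∀ e, σ e ∈ uIcc 0 (τ e)) :
    |∑ e, M e * σ e| ≤ ∑ e, |M e * τ e| := by
  refine (Finset.abs_sum_le_sum_abs _ _).trans (Finset.sum_le_sum fun e _ => ?_)
  rw [abs_mul, abs_mul]
  exact mul_le_mul_of_nonneg_left (abs_le_abs_of_mem_uIcc_zero (hσ e)) (abs_nonneg _)

/-- **Complex translation of the whole field** (FS81 (6.4), (4.36)): for a product of strip weights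
`∏ₚ fₚ((Mz)ₚ)` times a factor `G` holomorphic and bounded on the closed poly-strip
`{Im zₑ ∈ [[0, τₑ]]}`, and an imaginary translation vector `τ` with `∑ₑ |M_{pe}τₑ| < ε` for every
factor `p` (so that all partial translations stay in the strip of analyticity of the weights),
`∫ G(x) ∏ₚ fₚ((Mx)ₚ) dx = ∫ G(x + iτ) ∏ₚ fₚ((M(x + iτ))ₚ) dx`,
provided the real configuration integral `∫ ∏ₚ gₚ((Mx)ₚ) dx` converges. Here the translated
coordinates may share factors (no disjointness), at the price of analyticity of `G`.
[cite: FrohlichSpencerKT1981, Sect. 6 (6.4), p. 576; Lemma 4.4, (4.36), p. 557] -/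
theorem integral_mul_prod_eq_integral_translate_reIm
    (hw : ∀ p, IsStripWeight ε w (g p) (f p)) (M : P → E → ℝ) (τ : E → ℝ)
    (hτ : ∀ p, ∑ e, |M p e * τ e| < ε)
    {G : (E → ℂ) → ℂ} (hG : DifferentiableOn ℂ G {z : E → ℂ | ∀ e, (z e).im ∈ uIcc 0 (τ e)})
    {B : ℝ} (hGB : ∀ z : E → ℂ, (∀ e, (z e).im ∈ uIcc 0 (τ e)) → ‖G z‖ ≤ B)
    (hint : Integrable (fun x : E → ℝ => ∏ p, g p (∑ e, M p e * x e))) :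
    ∫ x : E → ℝ, G (fun e => (x e : ℂ)) * ∏ p, f p ((∑ e, M p e * x e : ℝ) : ℂ)
      = ∫ x : E → ℝ, G (reIm x τ) * ∏ p, f p (∑ e, (M p e : ℂ) * reIm x τ e) := by
  set F : (E → ℂ) → ℂ := fun z => G z * ∏ p, f p (∑ e, (M p e : ℂ) * z e) with hF_def
  -- the linear forms along `reIm x σ`
  have hlin : ∀ (x σ : E → ℝ) (p : P), ∑ e, (M p e : ℂ) * reIm x σ e =
      ((∑ e, M p e * x e : ℝ) : ℂ) + ((∑ e, M p e * σ e : ℝ) : ℂ) * I := by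
    intro x σ p
    simp only [reIm]
    push_cast
    rw [Finset.sum_mul, ← Finset.sum_add_distrib]
    exact Finset.sum_congr rfl fun e _ => by ring
  have hreal : ∀ x : E → ℝ, (fun e => (x e : ℂ)) = reIm x 0 := fun x => (reIm_zero x).symm
  -- holomorphy of `F` on the poly-strip
  have hF : DifferentiableOn ℂ F {z : E → ℂ | ∀ e, (z e).im ∈ uIcc 0 (τ e)} := by
    classical
    intro z hz
    refine (hG z hz).mul ?_
    have hfac : ∀ p : P, DifferentiableAt ℂ (fun z : E → ℂ => f p (∑ e, (M p e : ℂ) * z e)) z := by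
      intro p
      refine ((hw p).differentiableAt ?_).comp z (by fun_prop)
      -- `|Im (Mz)ₚ| ≤ ∑ |M_{pe} τₑ| < ε`
      have him : (∑ e, (M p e : ℂ) * z e).im = ∑ e, M p e * (z e).im := by
        rw [Complex.im_sum]
        exact Finset.sum_congr rfl fun e _ => by simp
      rw [him]
      exact (abs_sum_mul_le_of_mem_uIcc (M p) hz).trans_lt (hτ p)
    exact (HasFDerivAt.finsetProd (u := Finset.univ)
      (fun p _ => (hfac p).hasFDerivAt)).differentiableAt.differentiableWithinAt
  -- the majorant
  set C : ℝ := B * Real.exp (∑ p, w (∑ e, |M p e * τ e|)) with hC_def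
  have hdom : ∀ x σ : E → ℝ, (∀ e, σ e ∈ uIcc 0 (τ e)) →
      ‖F (reIm x σ)‖ ≤ C * ∏ p, g p (∑ e, M p e * x e) := by
    intro x σ hσ
    rw [hF_def]
    simp only
    rw [norm_mul, norm_prod, hC_def, mul_assoc, Real.exp_sum, ← Finset.prod_mul_distrib]
    have hB0 : 0 ≤ B := (norm_nonneg _).trans (hGB (reIm x σ) fun e => by simpa [reIm] using hσ e)
    refine mul_le_mul (hGB _ fun e => by simpa [reIm] using hσ e) ?_
      (Finset.prod_nonneg fun p _ => norm_nonneg _) hB0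
    refine Finset.prod_le_prod (fun p _ => norm_nonneg _) fun p _ => ?_
    rw [hlin x σ p]
    have h1 : |∑ e, M p e * σ e| ≤ ∑ e, |M p e * τ e| := abs_sum_mul_le_of_mem_uIcc (M p) hσ
    have h2 : |∑ e, M p e * σ e| < ε := h1.trans_lt (hτ p)
    refine ((hw p).norm_le _ _ h2).trans (mul_le_mul_of_nonneg_right ?_ ((hw p).pos _).le)
    have h3 : |∑ e, M p e * σ e| ≤ abs (∑ e, |M p e * τ e|) := by
      rwa [abs_of_nonneg (Finset.sum_nonneg (fun e _ => abs_nonneg (M p e * τ e)))]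
    exact Real.exp_le_exp.2 ((hw p).mono h3)
  have h := integral_eq_integral_reIm_of_differentiableOn F τ hF (hint.const_mul C) hdom
  have hL : ∀ x : E → ℝ, F (fun e => (x e : ℂ)) = G (fun e => (x e : ℂ)) * ∏ p, f p ((∑ e, M p e * x e : ℝ) : ℂ) := by
    intro x
    rw [hF_def]
    simp only
    congr 1
    refine Finset.prod_congr rfl fun p _ => ?_
    push_cast
    rfl
  simp only [hL] at h
  exact h

end Polystrip

end Literature.Probability.LatticeModels
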